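import Mathlib.MeasureTheory.Integral.MeanInequalities
import Mathlib.MeasureTheory.Function.L2Space
import Literature.Analysis.FluidPDE.ClassicalNSFourierModes
import Literature.Analysis.FunctionSpaces.TorusClassicalNSUniqueness
import Literature.Analysis.FluidPDE.FractionalGronwall
import HarnessLib

/-!
# Uniqueness from zero datum in Kato's weighted class for classical Navier–Stokes solutions on `T^d`

Analysis/FluidPDE support file (theorems only: no definition, no named fact). For a classical
solution `(u, p)` of the unforced incompressible Navier–Stokes system with viscosity `ν > 0` on the
half-open time interval `(0, T]` of the flat torus `T^d` (`Torus.IsClassicalNSSolutionOn (Ioc 0 T) ν 0 u p`,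
`Literature.Analysis.FunctionSpaces.TorusFluidGlue`) which

* has mean zero, `∫ u(t) = 0`;
* lies in a **sub-Kato weighted class** `‖u(t)‖_{L^∞} ≤ M t^{-β}` with `0 ≤ β < 1/2`
  (`t^{1/2}‖u(t)‖_∞ ≤ M t^{1/2-β} → 0`); and
* takes the **datum zero weakly**: `∫ ⟪u(t), φ⟫ → 0` as `t → 0⁺` against the divergence-free single
  Fourier modes `φ = Re (e_k z)`, `k · z = 0` (in particular if it does so against every smooth
  mean-zero field),

we prove `u ≡ 0` on `(0, T]` as soon as `M` is small: `M² (2/(1-2β) + 4)² T^{1-2β} < 4ν`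
(`Torus.IsClassicalNSSolutionOn.eq_zero_of_kato`, `….eq_zero_of_kato_of_pairing`). This is the
uniqueness-from-zero-datum statement behind fixed-point constructions in weighted-in-time spaces
`sup_t t^{γ}‖·‖_∞` (Kato 1984; Brezis 1994: uniqueness when `t^{1/2}‖u(t)‖_∞ → 0`), in the form
needed on the torus for classical solutions that are singular at `t = 0`; it is the analytic input
of the refutation of the over-generalised perturbation fact
`Literature.Barriers.NavierStokesRegularity.CoiculescuPalasek2025_perturbation`.

## Proof (Fourier side, no semigroup theory)

Test the momentum equation against the divergence-free single modes `a = Re (e_k z)`, `k·z = 0`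
(`Torus.IsClassicalNSSolutionOn.hasDerivWithinAt_re_inner_mFourierCoeff`, `ClassicalNSFourierModes`):
`y(τ) = Re ⟪û(τ,k), z⟫` obeys `y' = -4π²ν|k|² y + r(τ)` with the tested convective term
`r(τ) = ∫ ⟪u, (u·∇)a⟫ = Re (2πi ⟪A, 𝓕(u ⊗ u)(τ,-k)⟫)`, `A_{ij} = z̄ᵢ kⱼ`
(`integral_inner_convect_realTrigPoly_singleton`), whence `|r(τ)| ≤ 2π|k|‖z‖ ‖𝓕(u⊗u)(τ,-k)‖`
with the complexified tensor `u ⊗ u : T^d → ℂ^{d×d}`. Variation of constants on `[s, t]`, `s → 0⁺`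
and the transversal unit `z = û(t,k)/‖û(t,k)‖` give the mode bound
`‖û(t,k)‖ ≤ ∫₀ᵗ 2π|k| e^{-4π²ν|k|²(t-τ)} ‖𝓕(u⊗u)(τ,-k)‖ dτ` (`norm_mFourierCoeff_le_of_kato`).
Squaring with Cauchy–Schwarz in `τ` against the weight `(t-τ)^{-1/2}τ^{-2β}`, summing over `k`
(Parseval for `u(t)` and for `u⊗u(τ)`: `∑_k ‖𝓕(u⊗u)(τ,k)‖² = ∫ ‖u(τ)‖⁴ ≤ M²τ^{-2β}∫‖u(τ)‖²`, and
`4π²|k|² e^{-8π²ν|k|²σ} ≤ (4νσ)⁻¹`) yields the closed inequality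
`∫‖u(t)‖² ≤ (M²/4ν) I(t) ∫₀ᵗ (t-τ)^{-1/2} ∫‖u(τ)‖² dτ`, `I(t) = ∫₀ᵗ (t-τ)^{-1/2}τ^{-2β}dτ ≤ C_β t^{1/2-2β}`
(`integral_norm_sq_le_of_kato`), and the bootstrap `∫‖u(τ)‖² ≤ R τ^{-2β} ⟹ ∫‖u(t)‖² ≤ ρ R t^{-2β}`
with `ρ = M² C_β² T^{1-2β}/(4ν) < 1`, started at `R = M²`, forces `∫‖u(t)‖² = 0`.

## Mathlib / tree search

Tree: the tested momentum equation against single modes and the transversal-unit trick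
(`ClassicalNSFourierModes`), real modes `Torus.realTrigPoly {k}` with their calculus
(`TorusTrigPoly`, `TorusFourierModes`), Parseval for continuous `ℂ^ι`-valued functions
(`Torus.hasSum_sq_mFourierCoeff_euclidean`) and for real fields
(`Torus.integral_norm_sq_eq_tsum`), continuity in time of space integrals
(`TorusSpaceTimeFields`), the two-sided Abel–Beta bound `setIntegral_abel_rpow_rpow_le`
(`FractionalGronwall`). Whole-space Kato-class uniqueness in the tree (`KatoUniqueness*.lean`) is
for mild solutions on `ℝ³` in the very weak formulation and is not used. Mathlib: Hölder's
inequality `integral_mul_le_Lp_mul_Lq_of_nonneg`, `intervalIntegral.integral_eq_sub_of_hasDerivAt_of_le`.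

## References

* T. Kato, *Strong `L^p`-solutions of the Navier–Stokes equation in `ℝ^m`, with applications to
  weak solutions*, Math. Z. 187 (1984) 471–480, Thm. 1 and its proof (uniqueness in the weighted
  class). [Kato1984]
* H. Brezis, *Remarks on the preceding paper by M. Ben-Artzi "Global solutions of
  two-dimensional Navier–Stokes and Euler equations"*, Arch. Rational Mech. Anal. 128 (1994)
  359–360 (uniqueness under `t^{1/2}‖u(t)‖_∞ → 0`; cited for context only).
* J. C. Robinson, J. L. Rodrigo, W. Sadowski, *The Three-Dimensional Navier–Stokes Equations*
  (CUP 2016), (3.2)–(3.3), Thm. 4.4 Step 3 (testing against single modes). [RobinsonRodrigoSadowski2016]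
-/

noncomputable section

open MeasureTheory Set Filter UnitAddTorus Function
open scoped ENNReal NNReal InnerProductSpace RealInnerProductSpace Topology

namespace Literature.Analysis.FluidPDE

open Literature.Analysis.FunctionSpaces Literature.Analysis.FunctionSpaces.Torus

variable {d : Type*} [Fintype d] [DecidableEq d]

/-! ## Two elementary inequalities -/

omit [Fintype d] [DecidableEq d] in
/-- `y e^{-y} ≤ 1/2` for `y ≥ 0` (from `1 + y + y²/2 ≤ e^y` and `2y ≤ 1 + y + y²/2`). [folklore] -/
theorem mul_exp_neg_le_half {y : ℝ} (hy : 0 ≤ y) : y * Real.exp (-y) ≤ 1 / 2 := by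
  have h1 : 1 + y + y ^ 2 / 2 ≤ Real.exp y := Real.quadratic_le_exp_of_nonneg hy
  have h2 : 2 * y ≤ 1 + y + y ^ 2 / 2 := by nlinarith [sq_nonneg (y - 1)]
  rw [Real.exp_neg]
  have hpos : 0 < Real.exp y := Real.exp_pos y
  rw [mul_inv_le_iff₀ hpos]
  linarith

omit [Fintype d] [DecidableEq d] in
/-- **The heat multiplier with one derivative, squared**: for `X ≥ 0` (think `X = 4π²|k|²`),
`ν, σ > 0`: `X e^{-2νXσ} ≤ (4νσ)⁻¹`, i.e. `(2π|k|)² e^{-8π²ν|k|²σ} ≤ 1/(4νσ)`. [folklore] -/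
theorem mul_exp_neg_mul_le {X ν σ : ℝ} (hX : 0 ≤ X) (hν : 0 < ν) (hσ : 0 < σ) :
    X * Real.exp (-(2 * ν * X * σ)) ≤ 1 / (4 * ν * σ) := by
  have hνσ : 0 < 2 * ν * σ := by positivity
  have h := mul_exp_neg_le_half (y := 2 * ν * X * σ) (by positivity)
  have hX' : X = (2 * ν * X * σ) / (2 * ν * σ) := by
    field_simp
  calc X * Real.exp (-(2 * ν * X * σ))
      = ((2 * ν * X * σ) * Real.exp (-(2 * ν * X * σ))) / (2 * ν * σ) := by
        rw [mul_div_right_comm, ← hX']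
    _ ≤ (1 / 2) / (2 * ν * σ) := by gcongr
    _ = 1 / (4 * ν * σ) := by
        field_simp
        ring

/-! ## The complexified tensor `u ⊗ u` and the tested convective term against a single mode -/

section Tensor

omit [DecidableEq d] in
/-- The complexified tensor square of a real vector: `(v ⊗ v)_{ij} = vᵢ vⱼ ∈ ℂ`, as a vector of
`ℂ^{d × d}`. (Local notation of this file, spelled out in each statement.) Its norm:
`‖v ⊗ v‖ = ‖v‖²`. [folklore] -/
theorem norm_tensorSq (v : EuclideanSpace ℝ d) :
    ‖(WithLp.toLp 2 fun ij : d × d => ((v ij.1 * v ij.2 : ℝ) : ℂ) : EuclideanSpace ℂ (d × d))‖ =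
      ‖v‖ ^ 2 := by
  have h2 : ‖(WithLp.toLp 2 fun ij : d × d => ((v ij.1 * v ij.2 : ℝ) : ℂ) :
      EuclideanSpace ℂ (d × d))‖ ^ 2 = (‖v‖ ^ 2) ^ 2 := by
    rw [EuclideanSpace.norm_sq_eq, EuclideanSpace.norm_sq_eq]
    simp only [Complex.norm_real, Real.norm_eq_abs, sq_abs]
    rw [Fintype.sum_prod_type, pow_two (∑ i, v i ^ 2), Finset.sum_mul_sum]
    refine Finset.sum_congr rfl fun i _ => Finset.sum_congr rfl fun j _ => ?_
    ring
  have ha : 0 ≤ ‖(WithLp.toLp 2 fun ij : d × d => ((v ij.1 * v ij.2 : ℝ) : ℂ) :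
      EuclideanSpace ℂ (d × d))‖ := norm_nonneg _
  have hb : 0 ≤ ‖v‖ ^ 2 := sq_nonneg _
  nlinarith [h2, ha, hb, sq_nonneg (‖(WithLp.toLp 2 fun ij : d × d => ((v ij.1 * v ij.2 : ℝ) : ℂ) :
      EuclideanSpace ℂ (d × d))‖ - ‖v‖ ^ 2)]

omit [DecidableEq d] in
/-- The coefficient vector `A ∈ ℂ^{d×d}`, `A_{ij} = z̄ᵢ kⱼ`, has norm `‖A‖ = |k| ‖z‖`
(`‖A‖² = ∑ᵢⱼ |zᵢ|² kⱼ² = ‖z‖² |k|²`). [folklore] -/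
theorem norm_conj_mul_freq (k : d → ℤ) (z : EuclideanSpace ℂ d) :
    ‖(WithLp.toLp 2 fun ij : d × d => starRingEnd ℂ (z ij.1) * (k ij.2 : ℂ) :
        EuclideanSpace ℂ (d × d))‖ = Real.sqrt (freqNormSq k) * ‖z‖ := by
  have h2 : ‖(WithLp.toLp 2 fun ij : d × d => starRingEnd ℂ (z ij.1) * (k ij.2 : ℂ) :
      EuclideanSpace ℂ (d × d))‖ ^ 2 = freqNormSq k * ‖z‖ ^ 2 := by
    rw [EuclideanSpace.norm_sq_eq, EuclideanSpace.norm_sq_eq, freqNormSq]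
    simp only [norm_mul, Complex.norm_conj, Complex.norm_intCast]
    rw [Fintype.sum_prod_type, Finset.sum_mul_sum]
    rw [Finset.sum_comm]
    refine Finset.sum_congr rfl fun i _ => Finset.sum_congr rfl fun j _ => ?_
    rw [mul_pow, sq_abs]
    ring
  have hfq : 0 ≤ freqNormSq k := freqNormSq_nonneg k
  rw [← Real.sqrt_sq (norm_nonneg _), h2, Real.sqrt_mul hfq, Real.sqrt_sq (norm_nonneg _)]

/-- **The convective term tested against a single real mode, pointwise.** For a `C¹` field `u`,
a frequency `k`, `z ∈ ℂ^d` and `a = Re (e_k z)`: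
`⟪u(x), (u(x)·∇)a(x)⟫ = Re (2πi ⟪A, e_k(x) • (u ⊗ u)(x)⟫_ℂ)`, `A_{ij} = z̄ᵢ kⱼ`
(`∂ⱼa = Re (2πi kⱼ e_k z)`, `⟪v, Re w⟫ = Re ⟪complexify v, w⟫_ℂ`). [folklore] -/
theorem inner_convect_realTrigPoly_singleton (u : UnitAddTorus d → EuclideanSpace ℝ d)
    (k : d → ℤ) (z : EuclideanSpace ℂ d) (x : UnitAddTorus d) :
    ⟪u x, convect u (realTrigPoly {k} fun _ => z) x⟫ =
      (2 * Real.pi * Complex.I *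
        inner ℂ (WithLp.toLp 2 fun ij : d × d => starRingEnd ℂ (z ij.1) * (k ij.2 : ℂ) :
            EuclideanSpace ℂ (d × d))
          (mFourier k x • (WithLp.toLp 2 fun ij : d × d => ((u x ij.1 * u x ij.2 : ℝ) : ℂ) :
            EuclideanSpace ℂ (d × d)))).re := by
  have ha : IsContDiff 1 (realTrigPoly {k} fun _ => z) :=
    (isSmooth_realTrigPoly {k} _).isContDiff (by simp)
  unfold convect
  rw [fderiv_apply_eq_sum_partialDeriv ha, inner_sum]
  simp_rw [real_inner_smul_right, partialDeriv_realTrigPoly, realTrigPoly_singleton_apply,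
    EuclideanSpace.inner_realPart_eq_re_inner, inner_smul_right]
  -- the two complex inner products as explicit sums
  have hL : inner ℂ (EuclideanSpace.complexify (u x)) z = ∑ i, (u x i : ℂ) * z i := by
    rw [PiLp.inner_apply]
    refine Finset.sum_congr rfl fun i _ => ?_
    simp [EuclideanSpace.complexify_apply, mul_comm]
  have hR : inner ℂ (WithLp.toLp 2 fun ij : d × d => starRingEnd ℂ (z ij.1) * (k ij.2 : ℂ) :
        EuclideanSpace ℂ (d × d))
      (WithLp.toLp 2 fun ij : d × d => ((u x ij.1 * u x ij.2 : ℝ) : ℂ) :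
        EuclideanSpace ℂ (d × d)) =
      ∑ i, ∑ j, z i * (k j : ℂ) * ((u x i : ℂ) * (u x j : ℂ)) := by
    rw [PiLp.inner_apply, Fintype.sum_prod_type]
    refine Finset.sum_congr rfl fun i _ => Finset.sum_congr rfl fun j _ => ?_
    simp only [Complex.ofReal_mul]
    simp [map_mul, mul_comm, mul_assoc]
  rw [hR]
  simp_rw [hL]
  have hre : ∀ j, u x j * (mFourier k x * (2 * Real.pi * Complex.I * (k j : ℂ) *
      ∑ i, (u x i : ℂ) * z i)).re =
      ((u x j : ℂ) * (mFourier k x * (2 * Real.pi * Complex.I * (k j : ℂ) *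
      ∑ i, (u x i : ℂ) * z i))).re := fun j => by
    rw [Complex.re_ofReal_mul]
  simp_rw [hre]
  rw [← Complex.re_sum]
  congr 1
  simp only [Finset.mul_sum]
  rw [Finset.sum_comm]
  refine Finset.sum_congr rfl fun i _ => Finset.sum_congr rfl fun j _ => ?_
  ring

omit [Fintype d] [DecidableEq d] in
/-- Continuity of the complexified tensor `x ↦ (u ⊗ u)(x) ∈ ℂ^{d×d}` of a continuous field. [folklore] -/
theorem continuous_tensorSq {X : Type*} [TopologicalSpace X] {u : X → EuclideanSpace ℝ d}
    (hu : Continuous u) :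
    Continuous fun x =>
      (WithLp.toLp 2 fun ij : d × d => ((u x ij.1 * u x ij.2 : ℝ) : ℂ) : EuclideanSpace ℂ (d × d)) := by
  have hc : ∀ i, Continuous fun x => u x i := fun i =>
    (EuclideanSpace.proj i : EuclideanSpace ℝ d →L[ℝ] ℝ).continuous.comp hu
  refine (PiLp.continuous_toLp 2 _).comp ?_
  exact continuous_pi fun ij => Complex.continuous_ofReal.comp ((hc ij.1).mul (hc ij.2))

/-- **The convective term tested against a single real mode, integrated**:
`∫ ⟪u, (u·∇) Re (e_k z)⟫ = Re (2πi ⟪A, 𝓕(u ⊗ u)(-k)⟫_ℂ)`, `A_{ij} = z̄ᵢ kⱼ`, for continuous `u`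
(`∫ e_k • (u ⊗ u) = 𝓕(u ⊗ u)(-k)`). [folklore] -/
theorem integral_inner_convect_realTrigPoly_singleton {u : UnitAddTorus d → EuclideanSpace ℝ d}
    (hu : Continuous u) (k : d → ℤ) (z : EuclideanSpace ℂ d) :
    ∫ x, ⟪u x, convect u (realTrigPoly {k} fun _ => z) x⟫ =
      (2 * Real.pi * Complex.I *
        inner ℂ (WithLp.toLp 2 fun ij : d × d => starRingEnd ℂ (z ij.1) * (k ij.2 : ℂ) :
            EuclideanSpace ℂ (d × d))
          (mFourierCoeff (fun x => (WithLp.toLp 2 fun ij : d × d =>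
            ((u x ij.1 * u x ij.2 : ℝ) : ℂ) : EuclideanSpace ℂ (d × d))) (-k))).re := by
  simp_rw [inner_convect_realTrigPoly_singleton]
  set A : EuclideanSpace ℂ (d × d) :=
    WithLp.toLp 2 fun ij : d × d => starRingEnd ℂ (z ij.1) * (k ij.2 : ℂ) with hA
  set G : UnitAddTorus d → EuclideanSpace ℂ (d × d) := fun x =>
    WithLp.toLp 2 fun ij : d × d => ((u x ij.1 * u x ij.2 : ℝ) : ℂ) with hG
  have hGc : Continuous G := continuous_tensorSq hu
  have hint : Integrable (fun x => mFourier k x • G x) volume :=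
    ((mFourier k).continuous.smul hGc).integrable_unitAddTorus
  have h1 : ∫ x, (2 * Real.pi * Complex.I * inner ℂ A (mFourier k x • G x)).re =
      (∫ x, 2 * Real.pi * Complex.I * inner ℂ A (mFourier k x • G x)).re := by
    have h := integral_re (𝕜 := ℂ) ((hint.const_inner A).const_mul (2 * Real.pi * Complex.I))
    simpa only [RCLike.re_to_complex] using h
  change ∫ x, (2 * Real.pi * Complex.I * inner ℂ A (mFourier k x • G x)).re = _
  rw [h1, integral_const_mul, integral_inner hint A, mFourierCoeff_eq_integral_volume, neg_neg]

/-- **Bound for the tested convective term**: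
`|∫ ⟪u, (u·∇) Re (e_k z)⟫| ≤ 2π |k| ‖z‖ ‖𝓕(u ⊗ u)(-k)‖` (Cauchy–Schwarz in `ℂ^{d×d}`,
`‖A‖ = |k|‖z‖`). [folklore] -/
theorem abs_integral_inner_convect_realTrigPoly_singleton_le
    {u : UnitAddTorus d → EuclideanSpace ℝ d} (hu : Continuous u) (k : d → ℤ)
    (z : EuclideanSpace ℂ d) :
    |∫ x, ⟪u x, convect u (realTrigPoly {k} fun _ => z) x⟫| ≤
      2 * Real.pi * Real.sqrt (freqNormSq k) * ‖z‖ *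
        ‖mFourierCoeff (fun x => (WithLp.toLp 2 fun ij : d × d =>
            ((u x ij.1 * u x ij.2 : ℝ) : ℂ) : EuclideanSpace ℂ (d × d))) (-k)‖ := by
  rw [integral_inner_convect_realTrigPoly_singleton hu k z]
  refine (Complex.abs_re_le_norm _).trans ?_
  rw [norm_mul, norm_mul, norm_mul, Complex.norm_I, mul_one, Complex.norm_real, Complex.norm_two,
    Real.norm_eq_abs, abs_of_pos Real.pi_pos]
  calc 2 * Real.pi * ‖inner ℂ (WithLp.toLp 2 fun ij : d × d => starRingEnd ℂ (z ij.1) * (k ij.2 : ℂ) :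
            EuclideanSpace ℂ (d × d))
          (mFourierCoeff (fun x => (WithLp.toLp 2 fun ij : d × d =>
            ((u x ij.1 * u x ij.2 : ℝ) : ℂ) : EuclideanSpace ℂ (d × d))) (-k))‖
      ≤ 2 * Real.pi * (‖(WithLp.toLp 2 fun ij : d × d => starRingEnd ℂ (z ij.1) * (k ij.2 : ℂ) :
            EuclideanSpace ℂ (d × d))‖ *
          ‖mFourierCoeff (fun x => (WithLp.toLp 2 fun ij : d × d =>
            ((u x ij.1 * u x ij.2 : ℝ) : ℂ) : EuclideanSpace ℂ (d × d))) (-k)‖) := by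
        gcongr
        exact norm_inner_le_norm _ _
    _ = _ := by
        rw [norm_conj_mul_freq]
        ring

omit [DecidableEq d] in
/-- The Fourier coefficients of the tensor are bounded by `∫ ‖u‖²`:
`‖𝓕(u ⊗ u)(k)‖ ≤ ∫ ‖u ⊗ u‖ = ∫ ‖u‖²`. [folklore] -/
theorem norm_mFourierCoeff_tensorSq_le {u : UnitAddTorus d → EuclideanSpace ℝ d}
    (hu : Continuous u) (k : d → ℤ) :
    ‖mFourierCoeff (fun x => (WithLp.toLp 2 fun ij : d × d =>
        ((u x ij.1 * u x ij.2 : ℝ) : ℂ) : EuclideanSpace ℂ (d × d))) k‖ ≤ ∫ x, ‖u x‖ ^ 2 := by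
  rw [mFourierCoeff_eq_integral_volume]
  have hGc := continuous_tensorSq (d := d) hu
  refine (norm_integral_le_integral_norm _).trans ?_
  refine integral_mono (((mFourier (-k)).continuous.smul hGc).integrable_unitAddTorus).norm
    ((hu.norm.pow 2).integrable_unitAddTorus) fun x => ?_
  dsimp only
  rw [norm_smul, norm_tensorSq]
  have h1 : ‖mFourier (-k) x‖ ≤ 1 := ((mFourier (-k)).norm_coe_le_norm x).trans_eq mFourier_norm
  calc ‖mFourier (-k) x‖ * ‖u x‖ ^ 2 ≤ 1 * ‖u x‖ ^ 2 := by gcongr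
    _ = ‖u x‖ ^ 2 := one_mul _

end Tensor

/-! ## The mode bound: variation of constants from the weak zero datum -/

section ModeBound

variable {T ν : ℝ} {u : ℝ → UnitAddTorus d → EuclideanSpace ℝ d} {p : ℝ → UnitAddTorus d → ℝ}

/-- **Mode bound from the weak zero datum.** Let `(u, p)` be a classical solution of the unforced
Navier–Stokes system (`ν ≥ 0`) on `(0, T] × T^d` whose pairings with the divergence-free single
modes `Re (e_k z)`, `k · z = 0`, tend to `0` as `t → 0⁺`. Then for `k ≠ 0` and `t ∈ (0, T]`,
`‖û(t,k)‖ ≤ ∫_{(0,t)} e^{-4π²ν|k|²(t-τ)} · 2π|k| ‖𝓕(u ⊗ u)(τ,-k)‖ dτ`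
provided the right-hand side converges (tested momentum equation `y' = -4π²ν|k|² y + r`,
`|r| ≤ 2π|k| ‖𝓕(u⊗u)(τ,-k)‖`, for `y(τ) = Re ⟪û(τ,k), z⟫` with the transversal unit
`z = û(t,k)/‖û(t,k)‖`; variation of constants on `[s, t]` and `s → 0⁺`). [folklore] -/
theorem norm_mFourierCoeff_le_of_tendsto_pairing (h : IsClassicalNSSolutionOn (Ioc 0 T) ν 0 u p)
    (hν : 0 ≤ ν)
    (hlim : ∀ k : d → ℤ, k ≠ 0 → ∀ z : EuclideanSpace ℂ d, (∑ j, (k j : ℂ) * z j = 0) →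
      Tendsto (fun t => ∫ x, ⟪u t x, realTrigPoly {k} (fun _ => z) x⟫) (𝓝[>] 0) (𝓝 0))
    {k : d → ℤ} (hk : k ≠ 0) {t : ℝ} (ht : t ∈ Ioc 0 T)
    (hint : IntegrableOn (fun τ => ‖mFourierCoeff (fun x => (WithLp.toLp 2 fun ij : d × d =>
        ((u τ x ij.1 * u τ x ij.2 : ℝ) : ℂ) : EuclideanSpace ℂ (d × d))) (-k)‖) (Ioo 0 t)) :
    ‖mFourierCoeff (EuclideanSpace.complexify ∘ u t) k‖ ≤
      ∫ τ in Ioo 0 t, Real.exp (-(ν * (4 * Real.pi ^ 2 * freqNormSq k) * (t - τ))) *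
        (2 * Real.pi * Real.sqrt (freqNormSq k) *
          ‖mFourierCoeff (fun x => (WithLp.toLp 2 fun ij : d × d =>
            ((u τ x ij.1 * u τ x ij.2 : ℝ) : ℂ) : EuclideanSpace ℂ (d × d))) (-k)‖) := by
  -- notation
  set S : Set ℝ := Ioc 0 T with hSdef
  set lam : ℝ := ν * (4 * Real.pi ^ 2 * freqNormSq k) with hlam
  set B : ℝ → ℝ := fun τ => 2 * Real.pi * Real.sqrt (freqNormSq k) *
    ‖mFourierCoeff (fun x => (WithLp.toLp 2 fun ij : d × d =>
      ((u τ x ij.1 * u τ x ij.2 : ℝ) : ℂ) : EuclideanSpace ℂ (d × d))) (-k)‖ with hB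
  set J : ℝ := ∫ τ in Ioo 0 t, Real.exp (-(lam * (t - τ))) * B τ with hJ
  have ht0 : 0 < t := ht.1
  have hS : Convex ℝ S := convex_Ioc 0 T
  have hU : UniqueDiffOn ℝ S := uniqueDiffOn_Ioc 0 T
  have hu := h.smooth_velocity
  have hlam0 : 0 ≤ lam := by
    have := freqNormSq_nonneg k
    positivity
  have hB0 : ∀ τ, 0 ≤ B τ := fun τ => by
    have := Real.sqrt_nonneg (freqNormSq k)
    simp only [hB]; positivity
  -- integrability of the majorant on `(0, t)`
  have hJint : IntegrableOn (fun τ => Real.exp (-(lam * (t - τ))) * B τ) (Ioo 0 t) := by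
    have hBi : IntegrableOn B (Ioo 0 t) := by
      simp only [hB]
      exact hint.const_mul _
    refine Integrable.bdd_mul (c := 1) hBi ?_ ?_
    · exact (Real.continuous_exp.comp ((continuous_const.mul
        (continuous_const.sub continuous_id)).neg)).aestronglyMeasurable
    · refine (ae_restrict_iff' measurableSet_Ioo).2 (ae_of_all _ fun τ hτ => ?_)
      rw [Real.norm_eq_abs, abs_of_pos (Real.exp_pos _), Real.exp_le_one_iff, neg_nonpos]
      exact mul_nonneg hlam0 (sub_nonneg.2 hτ.2.le)
  have hJ0 : 0 ≤ J := setIntegral_nonneg measurableSet_Ioo fun τ _ =>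
    mul_nonneg (Real.exp_pos _).le (hB0 τ)
  -- the coefficient to be bounded
  set v : EuclideanSpace ℂ d := mFourierCoeff (EuclideanSpace.complexify ∘ u t) k with hv
  by_cases hv0 : v = 0
  · rw [hv0, norm_zero]; exact hJ0
  have hvk : ∑ j, (k j : ℂ) * v j = 0 :=
    IsDivFree.sum_mul_mFourierCoeff_eq_zero (hu.isSmooth_slice ht) (h.divFree t ht) k
  obtain ⟨z, hz, hz1, hvz⟩ := exists_transversal_unit_re_inner_eq hv0 hvk
  -- the tested equation along `z`
  set a : UnitAddTorus d → EuclideanSpace ℝ d := realTrigPoly {k} fun _ => z with ha_def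
  have ha : IsSmooth a := isSmooth_realTrigPoly _ _
  set φ : ℝ → ℝ := fun τ => (inner ℂ (mFourierCoeff (EuclideanSpace.complexify ∘ u τ) k) z).re
    with hφ
  set r : ℝ → ℝ := fun τ => ∫ x, ⟪u τ x, convect (u τ) a x⟫ with hr
  have hφa : ∀ τ ∈ S, φ τ = ∫ x, ⟪u τ x, a x⟫ := fun τ hτ =>
    (integral_inner_realTrigPoly_singleton ((hu.isSmooth_slice hτ).integrable) k (fun _ => z)).symm
  have hderiv : ∀ τ ∈ S, HasDerivWithinAt φ (r τ - lam * φ τ) S τ := by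
    intro τ hτ
    have hd := h.hasDerivWithinAt_re_inner_mFourierCoeff hS hU k hz hτ
    have hlap : ∫ x, ⟪u τ x, laplacian a x⟫ = -(4 * Real.pi ^ 2 * freqNormSq k) * ∫ x, ⟪u τ x, a x⟫ := by
      rw [← integral_const_mul]
      refine integral_congr_ae (ae_of_all _ fun x => ?_)
      dsimp only
      rw [ha_def, laplacian_realTrigPoly_singleton, inner_smul_right]
    have hzero : ∫ x, ⟪(0 : ℝ → UnitAddTorus d → EuclideanSpace ℝ d) τ x, a x⟫ = 0 := by
      simp
    convert hd using 1
    rw [hzero, add_zero, hlap, hφa τ hτ, hlam]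
    ring
  -- `r` is continuous on `S`, `|r| ≤ B`
  have hrc : ContinuousOn r S :=
    (hu.inner (hu.convect (isSmoothSpaceTimeOn_const ha S) hU)).continuousOn_integral hS
  have hrB : ∀ τ ∈ S, |r τ| ≤ B τ := fun τ hτ => by
    have hb := abs_integral_inner_convect_realTrigPoly_singleton_le
      ((hu.isSmooth_slice hτ).continuous) k z
    rw [hz1, mul_one] at hb
    exact hb
  -- variation of constants on `[s, t]`
  have hstep : ∀ s ∈ Ioo 0 t, ‖v‖ ≤ |φ s| + J := by
    intro s hs
    have hst : s ≤ t := hs.2.le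
    have hI : Icc s t ⊆ S := fun τ hτ => ⟨hs.1.trans_le hτ.1, hτ.2.trans ht.2⟩
    set ψ : ℝ → ℝ := fun τ => Real.exp (lam * τ) * φ τ with hψ
    have hψd : ∀ τ ∈ S, HasDerivWithinAt ψ (Real.exp (lam * τ) * r τ) S τ := by
      intro τ hτ
      have he : HasDerivWithinAt (fun σ => Real.exp (lam * σ)) (Real.exp (lam * τ) * lam) S τ := by
        have h1 : HasDerivAt (fun σ => lam * σ) lam τ := by
          simpa using (hasDerivAt_id τ).const_mul lam
        exact (h1.exp.hasDerivWithinAt).congr_deriv (by ring)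
      have := he.mul (hderiv τ hτ)
      refine this.congr_deriv ?_
      ring
    have hFTC : ∫ τ in s..t, Real.exp (lam * τ) * r τ = ψ t - ψ s :=
      intervalIntegral.integral_eq_sub_of_hasDerivAt_of_le hst
        (fun τ hτ => ((hψd τ (hI hτ)).continuousWithinAt).mono hI)
        (fun τ hτ => (hψd τ (hI (Ioo_subset_Icc_self hτ))).hasDerivAt
          (mem_of_superset (Icc_mem_nhds hτ.1 hτ.2) hI))
        ((((Real.continuous_exp.comp (continuous_const.mul continuous_id)).continuousOn.mul
          hrc).mono (hI.trans' (uIcc_of_le hst).subset)).intervalIntegrable)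
    -- bound the interval integral by `e^{lam t} J`
    have hbound : ∫ τ in s..t, Real.exp (lam * τ) * r τ ≤ Real.exp (lam * t) * J := by
      -- integrability of `e^{lam τ} B τ` on `[0, t]`
      have hBi : IntegrableOn B (Ioo 0 t) := by
        simp only [hB]
        exact hint.const_mul _
      have hBIcc : IntegrableOn (fun τ => Real.exp (lam * τ) * B τ) (Icc 0 t) := by
        have hB' : IntegrableOn B (Icc 0 t) := hBi.congr_set_ae Ioo_ae_eq_Icc.symm
        refine Integrable.bdd_mul (c := Real.exp (lam * t)) hB' ?_ ?_
        · exact (Real.continuous_exp.comp (continuous_const.mul continuous_id)).aestronglyMeasurable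
        · refine (ae_restrict_iff' measurableSet_Icc).2 (ae_of_all _ fun τ hτ => ?_)
          rw [Real.norm_eq_abs, abs_of_pos (Real.exp_pos _)]
          exact Real.exp_le_exp.2 (mul_le_mul_of_nonneg_left hτ.2 hlam0)
      have hIcc_sub : Ioc s t ⊆ Icc 0 t := fun τ hτ => ⟨(hs.1.trans hτ.1).le, hτ.2⟩
      have hii : IntervalIntegrable (fun τ => Real.exp (lam * τ) * B τ) volume s t :=
        (intervalIntegrable_iff_integrableOn_Ioc_of_le hst).2 (hBIcc.mono_set hIcc_sub)
      have hir : IntervalIntegrable (fun τ => Real.exp (lam * τ) * r τ) volume s t :=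
        (((Real.continuous_exp.comp (continuous_const.mul continuous_id)).continuousOn.mul
          hrc).mono (hI.trans' (uIcc_of_le hst).subset)).intervalIntegrable
      calc ∫ τ in s..t, Real.exp (lam * τ) * r τ
          ≤ ∫ τ in s..t, Real.exp (lam * τ) * B τ := by
            refine intervalIntegral.integral_mono_on hst hir hii fun τ hτ => ?_
            exact mul_le_mul_of_nonneg_left ((le_abs_self _).trans (hrB τ (hI hτ)))
              (Real.exp_pos _).le
        _ = ∫ τ in Ioc s t, Real.exp (lam * τ) * B τ := intervalIntegral.integral_of_le hst
        _ ≤ ∫ τ in Icc 0 t, Real.exp (lam * τ) * B τ := by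
            refine setIntegral_mono_set hBIcc ?_ (show Ioc s t ≤ Icc 0 t from hIcc_sub).eventuallyLE
            exact (ae_restrict_iff' measurableSet_Icc).2 (ae_of_all _ fun τ _ =>
              mul_nonneg (Real.exp_pos _).le (hB0 τ))
        _ = ∫ τ in Ioo 0 t, Real.exp (lam * τ) * B τ := integral_Icc_eq_integral_Ioo
        _ = Real.exp (lam * t) * J := by
            rw [hJ, ← integral_const_mul]
            refine integral_congr_ae (ae_of_all _ fun τ => ?_)
            show Real.exp (lam * τ) * B τ = Real.exp (lam * t) * (Real.exp (-(lam * (t - τ))) * B τ)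
            have he : Real.exp (lam * τ) = Real.exp (lam * t) * Real.exp (-(lam * (t - τ))) := by
              rw [← Real.exp_add]
              congr 1
              ring
            rw [he, mul_assoc]
    have hψt : ψ t = Real.exp (lam * t) * ‖v‖ := by
      simp only [hψ, hφ]
      rw [← hv, hvz]
    have hkey : Real.exp (lam * t) * ‖v‖ ≤ Real.exp (lam * s) * φ s + Real.exp (lam * t) * J := by
      have := hFTC.symm.le.trans hbound
      rw [hψt] at this
      simp only [hψ] at this
      linarith
    have hexp : 0 < Real.exp (lam * t) := Real.exp_pos _
    have hst' : Real.exp (lam * s) ≤ Real.exp (lam * t) :=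
      Real.exp_le_exp.2 (mul_le_mul_of_nonneg_left hst hlam0)
    have h3 : Real.exp (lam * s) * φ s ≤ Real.exp (lam * t) * |φ s| := by
      calc Real.exp (lam * s) * φ s ≤ Real.exp (lam * s) * |φ s| :=
            mul_le_mul_of_nonneg_left (le_abs_self _) (Real.exp_pos _).le
        _ ≤ Real.exp (lam * t) * |φ s| := mul_le_mul_of_nonneg_right hst' (abs_nonneg _)
    have h4 : Real.exp (lam * t) * ‖v‖ ≤ Real.exp (lam * t) * (|φ s| + J) := by
      rw [mul_add]; linarith
    exact le_of_mul_le_mul_left h4 hexp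
  -- `φ s → 0` as `s → 0⁺`
  have hφlim : Tendsto (fun s => |φ s| + J) (𝓝[>] 0) (𝓝 (|0| + J)) := by
    have h1 : Tendsto φ (𝓝[>] 0) (𝓝 0) := by
      refine (hlim k hk z hz).congr' ?_
      have hmem : S ∈ 𝓝[>] (0 : ℝ) := by
        rw [hSdef]
        exact Ioc_mem_nhdsGT (ht0.trans_le ht.2)
      filter_upwards [hmem] with s hs
      exact (hφa s hs).symm
    exact h1.abs.add tendsto_const_nhds
  rw [abs_zero, zero_add] at hφlim
  have hev : ∀ᶠ s in 𝓝[>] (0 : ℝ), ‖v‖ ≤ |φ s| + J := by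
    filter_upwards [Ioo_mem_nhdsGT ht0] with s hs
    exact hstep s hs
  exact ge_of_tendsto hφlim hev

end ModeBound

/-! ## Cauchy–Schwarz in time, Parseval in space: the closed `L²` inequality -/

section KeyInequality

omit [Fintype d] [DecidableEq d] in
/-- **Cauchy–Schwarz for real integrals, squared form**: `(∫ f g)² ≤ (∫ f²)(∫ g²)` for a.e.
nonnegative, a.e. strongly measurable `f, g` with `f², g²` integrable (Hölder with `p = q = 2`; the shorter name `sq_integral_mul_le` is taken by a
Jensen-type inequality in `MollifiedField`). [folklore] -/
theorem sq_integral_mul_le_of_sq_integrable {α : Type*} [MeasurableSpace α] {μ : Measure α} {f g : α → ℝ}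
    (hf : AEStronglyMeasurable f μ) (hg : AEStronglyMeasurable g μ) (hf0 : 0 ≤ᵐ[μ] f)
    (hg0 : 0 ≤ᵐ[μ] g) (hf2 : Integrable (fun x => f x ^ 2) μ) (hg2 : Integrable (fun x => g x ^ 2) μ) :
    (∫ x, f x * g x ∂μ) ^ 2 ≤ (∫ x, f x ^ 2 ∂μ) * ∫ x, g x ^ 2 ∂μ := by
  have hfm : MemLp f (ENNReal.ofReal 2) μ := by
    rw [show ENNReal.ofReal 2 = 2 by norm_num]
    exact (memLp_two_iff_integrable_sq hf).2 hf2
  have hgm : MemLp g (ENNReal.ofReal 2) μ := by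
    rw [show ENNReal.ofReal 2 = 2 by norm_num]
    exact (memLp_two_iff_integrable_sq hg).2 hg2
  have h := integral_mul_le_Lp_mul_Lq_of_nonneg Real.HolderConjugate.two_two hf0 hg0 hfm hgm
  have hA : 0 ≤ ∫ x, f x ^ 2 ∂μ := integral_nonneg fun x => sq_nonneg _
  have hB : 0 ≤ ∫ x, g x ^ 2 ∂μ := integral_nonneg fun x => sq_nonneg _
  have h2 : ∀ x : ℝ, x ^ (2 : ℝ) = x ^ 2 := fun x => Real.rpow_two x
  simp only [h2] at h
  have hI0 : 0 ≤ ∫ x, f x * g x ∂μ := by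
    refine integral_nonneg_of_ae ?_
    filter_upwards [hf0, hg0] with x hx hy
    exact mul_nonneg hx hy
  calc (∫ x, f x * g x ∂μ) ^ 2
      ≤ ((∫ x, f x ^ 2 ∂μ) ^ (1 / (2 : ℝ)) * (∫ x, g x ^ 2 ∂μ) ^ (1 / (2 : ℝ))) ^ 2 :=
        pow_le_pow_left₀ hI0 h 2
    _ = (∫ x, f x ^ 2 ∂μ) * ∫ x, g x ^ 2 ∂μ := by
        rw [mul_pow, ← Real.rpow_natCast, ← Real.rpow_natCast, ← Real.rpow_mul hA,
          ← Real.rpow_mul hB]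
        norm_num

variable {T ν : ℝ} {u : ℝ → UnitAddTorus d → EuclideanSpace ℝ d} {p : ℝ → UnitAddTorus d → ℝ}

omit [DecidableEq d] in
/-- `∫ ‖u‖² ≤ M² τ^{-2β}` from the pointwise bound `‖u(x)‖ ≤ M τ^{-β}` (the torus has volume
one). [folklore] -/
theorem integral_norm_sq_le_of_norm_le {w : UnitAddTorus d → EuclideanSpace ℝ d} (hw : Continuous w)
    {M τ β : ℝ} (hτ : 0 < τ) (hM : ∀ x, ‖w x‖ ≤ M * τ ^ (-β)) :
    ∫ x, ‖w x‖ ^ 2 ≤ M ^ 2 * τ ^ (-(2 * β)) := by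
  have hτβ : 0 < τ ^ (-β) := Real.rpow_pos_of_pos hτ _
  have hM0 : 0 ≤ M * τ ^ (-β) := by
    obtain ⟨x⟩ : Nonempty (UnitAddTorus d) := ⟨0⟩
    exact (norm_nonneg _).trans (hM x)
  have h1 : ∫ x, ‖w x‖ ^ 2 ≤ ∫ _ : UnitAddTorus d, (M * τ ^ (-β)) ^ 2 := by
    refine integral_mono (hw.norm.pow 2).integrable_unitAddTorus (integrable_const _) fun x => ?_
    exact pow_le_pow_left₀ (norm_nonneg _) (hM x) 2
  refine h1.trans (le_of_eq ?_)
  rw [integral_const, smul_eq_mul, Measure.real, measure_univ, ENNReal.toReal_one, one_mul, mul_pow,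
    ← Real.rpow_natCast (τ ^ (-β)), ← Real.rpow_mul hτ.le]
  congr 1
  norm_num
  ring_nf

omit [DecidableEq d] in
/-- `∫ ‖u ⊗ u‖² = ∫ ‖u‖⁴ ≤ M² τ^{-2β} ∫ ‖u‖²` from the pointwise bound. [folklore] -/
theorem integral_norm_tensorSq_sq_le {w : UnitAddTorus d → EuclideanSpace ℝ d} (hw : Continuous w)
    {M τ β : ℝ} (hτ : 0 < τ) (hM : ∀ x, ‖w x‖ ≤ M * τ ^ (-β)) :
    ∫ x, ‖(WithLp.toLp 2 fun ij : d × d => ((w x ij.1 * w x ij.2 : ℝ) : ℂ) :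
        EuclideanSpace ℂ (d × d))‖ ^ 2 ≤ M ^ 2 * τ ^ (-(2 * β)) * ∫ x, ‖w x‖ ^ 2 := by
  simp_rw [norm_tensorSq]
  rw [← integral_const_mul]
  have hτβ : 0 < τ ^ (-β) := Real.rpow_pos_of_pos hτ _
  refine integral_mono ((hw.norm.pow 2).pow 2).integrable_unitAddTorus
    (((hw.norm.pow 2).integrable_unitAddTorus).const_mul _) fun x => ?_
  dsimp only
  have h1 : ‖w x‖ ^ 2 ≤ M ^ 2 * τ ^ (-(2 * β)) := by
    calc ‖w x‖ ^ 2 ≤ (M * τ ^ (-β)) ^ 2 := pow_le_pow_left₀ (norm_nonneg _) (hM x) 2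
      _ = M ^ 2 * τ ^ (-(2 * β)) := by
          rw [mul_pow, ← Real.rpow_natCast (τ ^ (-β)), ← Real.rpow_mul hτ.le]
          congr 1; norm_num; ring_nf
  calc (‖w x‖ ^ 2) ^ 2 = ‖w x‖ ^ 2 * ‖w x‖ ^ 2 := sq _
    _ ≤ M ^ 2 * τ ^ (-(2 * β)) * ‖w x‖ ^ 2 :=
        mul_le_mul_of_nonneg_right h1 (sq_nonneg _)

omit [DecidableEq d] in
/-- **Bessel/Parseval for the tensor**: for every finite set of frequencies `K`,
`∑_{k∈K} ‖𝓕(u ⊗ u)(-k)‖² ≤ ∫ ‖u ⊗ u‖²`. [folklore] -/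
theorem sum_norm_sq_mFourierCoeff_tensorSq_le {w : UnitAddTorus d → EuclideanSpace ℝ d}
    (hw : Continuous w) (K : Finset (d → ℤ)) :
    ∑ k ∈ K, ‖mFourierCoeff (fun x => (WithLp.toLp 2 fun ij : d × d =>
        ((w x ij.1 * w x ij.2 : ℝ) : ℂ) : EuclideanSpace ℂ (d × d))) (-k)‖ ^ 2 ≤
      ∫ x, ‖(WithLp.toLp 2 fun ij : d × d => ((w x ij.1 * w x ij.2 : ℝ) : ℂ) :
        EuclideanSpace ℂ (d × d))‖ ^ 2 := by
  have hP := hasSum_sq_mFourierCoeff_euclidean (continuous_tensorSq (d := d) hw)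
  -- reindex `k ↦ -k`
  have hre : ∑ k ∈ K, ‖mFourierCoeff (fun x => (WithLp.toLp 2 fun ij : d × d =>
        ((w x ij.1 * w x ij.2 : ℝ) : ℂ) : EuclideanSpace ℂ (d × d))) (-k)‖ ^ 2 =
      ∑ k ∈ K.image Neg.neg, ‖mFourierCoeff (fun x => (WithLp.toLp 2 fun ij : d × d =>
        ((w x ij.1 * w x ij.2 : ℝ) : ℂ) : EuclideanSpace ℂ (d × d))) k‖ ^ 2 := by
    rw [Finset.sum_image fun a _ b _ h => neg_injective h]
  rw [hre]
  exact sum_le_hasSum _ (fun k _ => sq_nonneg _) hP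

omit [DecidableEq d] in
/-- The Fourier coefficients of the tensor of a jointly continuous field depend continuously on
time. [folklore] -/
theorem continuousOn_mFourierCoeff_tensorSq {S : Set ℝ} (hu : ContinuousOn (stLift u) (S ×ˢ univ))
    (k : d → ℤ) :
    ContinuousOn (fun τ => mFourierCoeff (fun x => (WithLp.toLp 2 fun ij : d × d =>
        ((u τ x ij.1 * u τ x ij.2 : ℝ) : ℂ) : EuclideanSpace ℂ (d × d))) k) S := by
  have hG : ContinuousOn (stLift fun τ x => (WithLp.toLp 2 fun ij : d × d =>
      ((u τ x ij.1 * u τ x ij.2 : ℝ) : ℂ) : EuclideanSpace ℂ (d × d))) (S ×ˢ univ) := by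
    have h1 : ContinuousOn (fun q : ℝ × EuclideanSpace ℝ d => (WithLp.toLp 2 fun ij : d × d =>
        ((stLift u q ij.1 * stLift u q ij.2 : ℝ) : ℂ) : EuclideanSpace ℂ (d × d))) (S ×ˢ univ) :=
      (continuous_tensorSq (d := d) continuous_id).comp_continuousOn hu
    exact h1
  have h2 : ContinuousOn (stLift fun τ x => mFourier (-k) x • (WithLp.toLp 2 fun ij : d × d =>
      ((u τ x ij.1 * u τ x ij.2 : ℝ) : ℂ) : EuclideanSpace ℂ (d × d))) (S ×ˢ univ) := by
    have h3 : ContinuousOn (fun q : ℝ × EuclideanSpace ℝ d => mFourier (-k) (proj q.2)) (S ×ˢ univ) :=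
      ((mFourier (-k)).continuous.comp (continuous_proj.comp continuous_snd)).continuousOn
    exact h3.smul hG
  have h4 := continuousOn_integral_of_continuousOn_stLift h2
  refine h4.congr fun τ _ => ?_
  exact mFourierCoeff_eq_integral_volume _ _

omit [DecidableEq d] in
/-- Integrability on `(0, t)` of the weighted squared tensor coefficient
`τ ↦ (t-τ)^{-1/2} τ^{2β} ‖𝓕(u⊗u)(τ,k)‖²` for a jointly smooth field in the Kato class
(it is continuous on `(0, t)` and at most `M⁴ (t-τ)^{-1/2} τ^{-2β}`). [folklore] -/
theorem integrableOn_weight_mul_sq_norm_mFourierCoeff_tensorSq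
    (hu : IsSmoothSpaceTimeOn (Ioc 0 T) u) {M β : ℝ} (hβ : 0 ≤ β) (hβ2 : 2 * β < 1)
    (hM : ∀ τ ∈ Ioc 0 T, ∀ x, ‖u τ x‖ ≤ M * τ ^ (-β)) {t : ℝ} (ht : t ∈ Ioc 0 T) (k : d → ℤ) :
    IntegrableOn (fun τ => (t - τ) ^ (-(1 / 2 : ℝ)) * τ ^ (2 * β) *
      ‖mFourierCoeff (fun x => (WithLp.toLp 2 fun ij : d × d =>
        ((u τ x ij.1 * u τ x ij.2 : ℝ) : ℂ) : EuclideanSpace ℂ (d × d))) k‖ ^ 2) (Ioo 0 t) ∧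
    ∀ τ ∈ Ioo 0 t, (t - τ) ^ (-(1 / 2 : ℝ)) * τ ^ (2 * β) *
      ‖mFourierCoeff (fun x => (WithLp.toLp 2 fun ij : d × d =>
        ((u τ x ij.1 * u τ x ij.2 : ℝ) : ℂ) : EuclideanSpace ℂ (d × d))) k‖ ^ 2 ≤
      M ^ 4 * ((t - τ) ^ (-(1 / 2 : ℝ)) * τ ^ (-(2 * β))) := by
  set S : Set ℝ := Ioc 0 T with hSdef
  set Gh : ℝ → ℝ := fun τ => ‖mFourierCoeff (fun x => (WithLp.toLp 2 fun ij : d × d =>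
      ((u τ x ij.1 * u τ x ij.2 : ℝ) : ℂ) : EuclideanSpace ℂ (d × d))) k‖ with hGh
  have ht0 : 0 < t := ht.1
  have hsub : Ioo 0 t ⊆ S := fun τ hτ => ⟨hτ.1, hτ.2.le.trans ht.2⟩
  have hGc : ContinuousOn (fun τ => mFourierCoeff (fun x => (WithLp.toLp 2 fun ij : d × d =>
      ((u τ x ij.1 * u τ x ij.2 : ℝ) : ℂ) : EuclideanSpace ℂ (d × d))) k) S :=
    continuousOn_mFourierCoeff_tensorSq hu.continuousOn_stLift k
  have hGhc : ContinuousOn Gh (Ioo 0 t) := (hGc.mono hsub).norm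
  have hGh0 : ∀ τ, 0 ≤ Gh τ := fun τ => norm_nonneg _
  have hGhbd : ∀ τ ∈ Ioo 0 t, Gh τ ≤ M ^ 2 * τ ^ (-(2 * β)) := fun τ hτ => by
    have hc : Continuous (u τ) := (hu.isSmooth_slice (hsub hτ)).continuous
    exact (norm_mFourierCoeff_tensorSq_le hc k).trans
      (integral_norm_sq_le_of_norm_le hc hτ.1 (hM τ (hsub hτ)))
  have hwi : IntegrableOn (fun τ => (t - τ) ^ (-(1 / 2 : ℝ)) * τ ^ (-(2 * β))) (Ioo 0 t) :=
    (setIntegral_abel_rpow_rpow_le (a := 1 / 2) (b := 2 * β) (by norm_num) (by norm_num)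
      (by linarith) hβ2 ht0).1
  have hbd : ∀ τ ∈ Ioo 0 t, (t - τ) ^ (-(1 / 2 : ℝ)) * τ ^ (2 * β) * Gh τ ^ 2 ≤
      M ^ 4 * ((t - τ) ^ (-(1 / 2 : ℝ)) * τ ^ (-(2 * β))) := by
    intro τ hτ
    have h1 : 0 ≤ (t - τ) ^ (-(1 / 2 : ℝ)) := Real.rpow_nonneg (sub_nonneg.2 hτ.2.le) _
    have h2 : 0 ≤ τ ^ (2 * β) := Real.rpow_nonneg hτ.1.le _
    have h3 : Gh τ ^ 2 ≤ (M ^ 2 * τ ^ (-(2 * β))) ^ 2 :=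
      pow_le_pow_left₀ (hGh0 τ) (hGhbd τ hτ) 2
    have h4 : τ ^ (2 * β) * (τ ^ (-(2 * β))) ^ 2 = τ ^ (-(2 * β)) := by
      rw [sq, ← mul_assoc, ← Real.rpow_add hτ.1]
      norm_num
    calc (t - τ) ^ (-(1 / 2 : ℝ)) * τ ^ (2 * β) * Gh τ ^ 2
        ≤ (t - τ) ^ (-(1 / 2 : ℝ)) * τ ^ (2 * β) * (M ^ 2 * τ ^ (-(2 * β))) ^ 2 :=
          mul_le_mul_of_nonneg_left h3 (mul_nonneg h1 h2)
      _ = M ^ 4 * ((t - τ) ^ (-(1 / 2 : ℝ)) * (τ ^ (2 * β) * (τ ^ (-(2 * β))) ^ 2)) := by ring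
      _ = M ^ 4 * ((t - τ) ^ (-(1 / 2 : ℝ)) * τ ^ (-(2 * β))) := by rw [h4]
  have h0 : ∀ τ ∈ Ioo 0 t, 0 ≤ (t - τ) ^ (-(1 / 2 : ℝ)) * τ ^ (2 * β) * Gh τ ^ 2 := fun τ hτ =>
    mul_nonneg (mul_nonneg (Real.rpow_nonneg (sub_nonneg.2 hτ.2.le) _)
      (Real.rpow_nonneg hτ.1.le _)) (sq_nonneg _)
  have hpow1 : ∀ r : ℝ, ContinuousOn (fun τ : ℝ => (t - τ) ^ r) (Ioo 0 t) := fun r =>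
    (continuousOn_const.sub continuousOn_id).rpow_const fun τ hτ => Or.inl (sub_pos.2 hτ.2).ne'
  have hpow2 : ∀ r : ℝ, ContinuousOn (fun τ : ℝ => τ ^ r) (Ioo 0 t) := fun r =>
    continuousOn_id.rpow_const fun τ hτ => Or.inl hτ.1.ne'
  have hc : ContinuousOn (fun τ => (t - τ) ^ (-(1 / 2 : ℝ)) * τ ^ (2 * β) * Gh τ ^ 2) (Ioo 0 t) :=
    ((hpow1 _).mul (hpow2 _)).mul (hGhc.pow 2)
  refine ⟨?_, hbd⟩
  refine Integrable.mono' (hwi.const_mul (M ^ 4)) (hc.aestronglyMeasurable measurableSet_Ioo) ?_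
  refine (ae_restrict_iff' measurableSet_Ioo).2 (ae_of_all _ fun τ hτ => ?_)
  rw [Real.norm_eq_abs, abs_of_nonneg (h0 τ hτ)]
  exact hbd τ hτ

/-- **Squared mode bound in the Kato class** (Cauchy–Schwarz in time). Under the hypotheses of
`norm_mFourierCoeff_le_of_tendsto_pairing` and the pointwise bound `‖u(τ,x)‖ ≤ M τ^{-β}`,
`0 ≤ β`, `2β < 1`, `ν > 0`: for `k ≠ 0` and `t ∈ (0, T]`,
`‖û(t,k)‖² ≤ I(t) · (4ν)⁻¹ ∫_{(0,t)} (t-τ)^{-1/2} τ^{2β} ‖𝓕(u⊗u)(τ,-k)‖² dτ`,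
`I(t) = ∫_{(0,t)} (t-τ)^{-1/2} τ^{-2β} dτ` (split the mode-bound integrand as
`[(t-τ)^{-1/4}τ^{-β}] · [(t-τ)^{1/4}τ^{β} e^{-4π²ν|k|²(t-τ)} 2π|k| ‖𝓕(u⊗u)(τ,-k)‖]` and use
`4π²|k|² e^{-8π²ν|k|²σ} ≤ (4νσ)⁻¹`). [folklore] -/
theorem sq_norm_mFourierCoeff_le_of_kato (h : IsClassicalNSSolutionOn (Ioc 0 T) ν 0 u p)
    (hν : 0 < ν)
    (hlim : ∀ k : d → ℤ, k ≠ 0 → ∀ z : EuclideanSpace ℂ d, (∑ j, (k j : ℂ) * z j = 0) →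
      Tendsto (fun t => ∫ x, ⟪u t x, realTrigPoly {k} (fun _ => z) x⟫) (𝓝[>] 0) (𝓝 0))
    {M β : ℝ} (hβ : 0 ≤ β) (hβ2 : 2 * β < 1)
    (hM : ∀ τ ∈ Ioc 0 T, ∀ x, ‖u τ x‖ ≤ M * τ ^ (-β)) {t : ℝ} (ht : t ∈ Ioc 0 T)
    {k : d → ℤ} (hk : k ≠ 0) :
    ‖mFourierCoeff (EuclideanSpace.complexify ∘ u t) k‖ ^ 2 ≤
      (∫ τ in Ioo 0 t, (t - τ) ^ (-(1 / 2 : ℝ)) * τ ^ (-(2 * β))) *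
        (1 / (4 * ν) * ∫ τ in Ioo 0 t, (t - τ) ^ (-(1 / 2 : ℝ)) * τ ^ (2 * β) *
          ‖mFourierCoeff (fun x => (WithLp.toLp 2 fun ij : d × d =>
            ((u τ x ij.1 * u τ x ij.2 : ℝ) : ℂ) : EuclideanSpace ℂ (d × d))) (-k)‖ ^ 2) := by
  set S : Set ℝ := Ioc 0 T with hSdef
  set X : ℝ := 4 * Real.pi ^ 2 * freqNormSq k with hX
  set Gh : ℝ → ℝ := fun τ => ‖mFourierCoeff (fun x => (WithLp.toLp 2 fun ij : d × d =>
      ((u τ x ij.1 * u τ x ij.2 : ℝ) : ℂ) : EuclideanSpace ℂ (d × d))) (-k)‖ with hGh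
  set e : ℝ → ℝ := fun τ => Real.exp (-(ν * X * (t - τ))) with he
  set Bk : ℝ → ℝ := fun τ => 2 * Real.pi * Real.sqrt (freqNormSq k) * Gh τ with hBk
  set w : ℝ → ℝ := fun τ => (t - τ) ^ (-(1 / 2 : ℝ)) * τ ^ (-(2 * β)) with hw_def
  set f : ℝ → ℝ := fun τ => (t - τ) ^ (-(1 / 4 : ℝ)) * τ ^ (-β) with hf_def
  set g : ℝ → ℝ := fun τ => (t - τ) ^ (1 / 4 : ℝ) * τ ^ β * (e τ * Bk τ) with hg_def
  set hk' : ℝ → ℝ := fun τ => (t - τ) ^ (-(1 / 2 : ℝ)) * τ ^ (2 * β) * Gh τ ^ 2 with hhk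
  have ht0 : 0 < t := ht.1
  have hu := h.smooth_velocity
  have hsub : Ioo 0 t ⊆ S := fun τ hτ => ⟨hτ.1, hτ.2.le.trans ht.2⟩
  have hX0 : 0 ≤ X := by
    have := freqNormSq_nonneg k
    positivity
  have hM0 : 0 ≤ M := by
    have h1 := hM t ht (0 : UnitAddTorus d)
    have h2 : 0 < t ^ (-β) := Real.rpow_pos_of_pos ht0 _
    nlinarith [norm_nonneg (u t 0)]
  -- continuity and bounds of the tensor coefficient
  have hGc : ContinuousOn (fun τ => mFourierCoeff (fun x => (WithLp.toLp 2 fun ij : d × d =>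
      ((u τ x ij.1 * u τ x ij.2 : ℝ) : ℂ) : EuclideanSpace ℂ (d × d))) (-k)) S :=
    continuousOn_mFourierCoeff_tensorSq hu.continuousOn_stLift (-k)
  have hGhc : ContinuousOn Gh (Ioo 0 t) := (hGc.mono hsub).norm
  have hGh0 : ∀ τ, 0 ≤ Gh τ := fun τ => norm_nonneg _
  have hGhbd : ∀ τ ∈ Ioo 0 t, Gh τ ≤ M ^ 2 * τ ^ (-(2 * β)) := fun τ hτ => by
    have hc : Continuous (u τ) := (hu.isSmooth_slice (hsub hτ)).continuous
    exact (norm_mFourierCoeff_tensorSq_le hc (-k)).trans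
      (integral_norm_sq_le_of_norm_le hc hτ.1 (hM τ (hsub hτ)))
  -- the weight and its integrability
  have hwi : IntegrableOn w (Ioo 0 t) :=
    (setIntegral_abel_rpow_rpow_le (a := 1 / 2) (b := 2 * β) (by norm_num) (by norm_num)
      (by linarith) hβ2 ht0).1
  have hI0 : 0 ≤ ∫ τ in Ioo 0 t, w τ :=
    setIntegral_nonneg measurableSet_Ioo fun τ hτ => mul_nonneg
      (Real.rpow_nonneg (sub_nonneg.2 hτ.2.le) _) (Real.rpow_nonneg hτ.1.le _)
  -- integrability of `Gh` on `(0, t)` and the mode bound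
  have hint : IntegrableOn Gh (Ioo 0 t) := by
    refine Integrable.mono' ((integrableOn_rpow_Ioo (a := 0) (b := t) (r := -(2 * β))
      (by linarith)).const_mul (M ^ 2)) (hGhc.aestronglyMeasurable measurableSet_Ioo) ?_
    refine (ae_restrict_iff' measurableSet_Ioo).2 (ae_of_all _ fun τ hτ => ?_)
    rw [Real.norm_eq_abs, abs_of_nonneg (hGh0 τ)]
    exact hGhbd τ hτ
  have hmode : ‖mFourierCoeff (EuclideanSpace.complexify ∘ u t) k‖ ≤ ∫ τ in Ioo 0 t, e τ * Bk τ := by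
    have := norm_mFourierCoeff_le_of_tendsto_pairing h hν.le hlim hk ht hint
    simpa only [he, hBk, hGh, hX, mul_assoc] using this
  -- pointwise identities on `(0, t)`
  have hfg : ∀ τ ∈ Ioo 0 t, f τ * g τ = e τ * Bk τ := by
    intro τ hτ
    have h1 : 0 < t - τ := sub_pos.2 hτ.2
    simp only [hf_def, hg_def]
    have ha : (t - τ) ^ (-(1 / 4 : ℝ)) * (t - τ) ^ (1 / 4 : ℝ) = 1 := by
      rw [← Real.rpow_add h1]; norm_num
    have hb : τ ^ (-β) * τ ^ β = 1 := by
      rw [← Real.rpow_add hτ.1]; norm_num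
    calc (t - τ) ^ (-(1 / 4 : ℝ)) * τ ^ (-β) * ((t - τ) ^ (1 / 4 : ℝ) * τ ^ β * (e τ * Bk τ))
        = ((t - τ) ^ (-(1 / 4 : ℝ)) * (t - τ) ^ (1 / 4 : ℝ)) * (τ ^ (-β) * τ ^ β) *
            (e τ * Bk τ) := by ring
      _ = e τ * Bk τ := by rw [ha, hb, one_mul, one_mul]
  have hf2 : ∀ τ ∈ Ioo 0 t, f τ ^ 2 = w τ := by
    intro τ hτ
    have h1 : 0 < t - τ := sub_pos.2 hτ.2
    simp only [hf_def, hw_def]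
    rw [mul_pow, ← Real.rpow_natCast ((t - τ) ^ (-(1 / 4 : ℝ))), ← Real.rpow_mul h1.le,
      ← Real.rpow_natCast (τ ^ (-β)), ← Real.rpow_mul hτ.1.le]
    norm_num
    left
    ring_nf
  have hg2 : ∀ τ ∈ Ioo 0 t, g τ ^ 2 ≤ 1 / (4 * ν) * hk' τ := by
    intro τ hτ
    have h1 : 0 < t - τ := sub_pos.2 hτ.2
    simp only [hg_def, hhk, hBk, he]
    -- `e² (2π|k|)² = X e^{-2νXσ} · 1 ≤ (4νσ)⁻¹`
    have hkey : Real.exp (-(ν * X * (t - τ))) ^ 2 * (2 * Real.pi * Real.sqrt (freqNormSq k)) ^ 2 ≤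
        1 / (4 * ν * (t - τ)) := by
      have hsq : (2 * Real.pi * Real.sqrt (freqNormSq k)) ^ 2 = X := by
        rw [hX, mul_pow, mul_pow, Real.sq_sqrt (freqNormSq_nonneg k)]
        ring
      have hexp : Real.exp (-(ν * X * (t - τ))) ^ 2 = Real.exp (-(2 * ν * X * (t - τ))) := by
        rw [← Real.exp_nat_mul]
        congr 1
        push_cast
        ring
      rw [hsq, hexp, mul_comm]
      exact mul_exp_neg_mul_le hX0 hν h1
    have hA : ((t - τ) ^ (1 / 4 : ℝ) * τ ^ β) ^ 2 = (t - τ) ^ (1 / 2 : ℝ) * τ ^ (2 * β) := by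
      rw [mul_pow, ← Real.rpow_natCast ((t - τ) ^ (1 / 4 : ℝ)), ← Real.rpow_mul h1.le,
        ← Real.rpow_natCast (τ ^ β), ← Real.rpow_mul hτ.1.le]
      norm_num
      left
      ring_nf
    have hB' : (t - τ) ^ (1 / 2 : ℝ) * (1 / (4 * ν * (t - τ))) = 1 / (4 * ν) * (t - τ) ^ (-(1 / 2 : ℝ)) := by
      have : (t - τ) ^ (-(1 / 2 : ℝ)) = (t - τ) ^ (1 / 2 : ℝ) * (t - τ)⁻¹ := by
        rw [← Real.rpow_neg_one, ← Real.rpow_add h1]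
        norm_num
      rw [this]
      field_simp
    calc ((t - τ) ^ (1 / 4 : ℝ) * τ ^ β * (Real.exp (-(ν * X * (t - τ))) *
          (2 * Real.pi * Real.sqrt (freqNormSq k) * Gh τ))) ^ 2
        = ((t - τ) ^ (1 / 4 : ℝ) * τ ^ β) ^ 2 *
            (Real.exp (-(ν * X * (t - τ))) ^ 2 * (2 * Real.pi * Real.sqrt (freqNormSq k)) ^ 2) *
            Gh τ ^ 2 := by ring
      _ ≤ ((t - τ) ^ (1 / 4 : ℝ) * τ ^ β) ^ 2 * (1 / (4 * ν * (t - τ))) * Gh τ ^ 2 := by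
          gcongr
      _ = 1 / (4 * ν) * ((t - τ) ^ (-(1 / 2 : ℝ)) * τ ^ (2 * β) * Gh τ ^ 2) := by
          rw [hA]
          calc (t - τ) ^ (1 / 2 : ℝ) * τ ^ (2 * β) * (1 / (4 * ν * (t - τ))) * Gh τ ^ 2
              = ((t - τ) ^ (1 / 2 : ℝ) * (1 / (4 * ν * (t - τ)))) * τ ^ (2 * β) * Gh τ ^ 2 := by
                ring
            _ = _ := by rw [hB']; ring
  -- integrability of the majorant `hk' ≤ M⁴ w`
  have hhki : IntegrableOn hk' (Ioo 0 t) :=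
    (integrableOn_weight_mul_sq_norm_mFourierCoeff_tensorSq hu hβ hβ2 hM ht (-k)).1
  -- measurability
  have hpow1 : ∀ r : ℝ, ContinuousOn (fun τ : ℝ => (t - τ) ^ r) (Ioo 0 t) := fun r =>
    (continuousOn_const.sub continuousOn_id).rpow_const fun τ hτ => Or.inl (sub_pos.2 hτ.2).ne'
  have hpow2 : ∀ r : ℝ, ContinuousOn (fun τ : ℝ => τ ^ r) (Ioo 0 t) := fun r =>
    continuousOn_id.rpow_const fun τ hτ => Or.inl hτ.1.ne'
  have hec : Continuous e := Real.continuous_exp.comp ((continuous_const.mul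
    (continuous_const.sub continuous_id)).neg)
  have hBkc : ContinuousOn Bk (Ioo 0 t) := continuousOn_const.mul hGhc
  have hfm : AEStronglyMeasurable f (volume.restrict (Ioo 0 t)) :=
    ((hpow1 _).mul (hpow2 _)).aestronglyMeasurable measurableSet_Ioo
  have hgc : ContinuousOn g (Ioo 0 t) := ((hpow1 _).mul (hpow2 _)).mul (hec.continuousOn.mul hBkc)
  have hgm : AEStronglyMeasurable g (volume.restrict (Ioo 0 t)) := hgc.aestronglyMeasurable measurableSet_Ioo
  have hf0 : 0 ≤ᵐ[volume.restrict (Ioo 0 t)] f :=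
    (ae_restrict_iff' measurableSet_Ioo).2 (ae_of_all _ fun τ hτ => mul_nonneg
      (Real.rpow_nonneg (sub_nonneg.2 hτ.2.le) _) (Real.rpow_nonneg hτ.1.le _))
  have he0 : ∀ τ, 0 ≤ e τ := fun τ => (Real.exp_pos _).le
  have hBk0 : ∀ τ, 0 ≤ Bk τ := fun τ => by
    simp only [hBk]
    have := Real.sqrt_nonneg (freqNormSq k)
    have := hGh0 τ
    positivity
  have hg0 : 0 ≤ᵐ[volume.restrict (Ioo 0 t)] g :=
    (ae_restrict_iff' measurableSet_Ioo).2 (ae_of_all _ fun τ hτ => mul_nonneg (mul_nonneg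
      (Real.rpow_nonneg (sub_nonneg.2 hτ.2.le) _) (Real.rpow_nonneg hτ.1.le _))
      (mul_nonneg (he0 τ) (hBk0 τ)))
  have hf2i : Integrable (fun τ => f τ ^ 2) (volume.restrict (Ioo 0 t)) := by
    refine hwi.congr ?_
    refine (ae_restrict_iff' measurableSet_Ioo).2 (ae_of_all _ fun τ hτ => ?_)
    exact (hf2 τ hτ).symm
  have hg2i : Integrable (fun τ => g τ ^ 2) (volume.restrict (Ioo 0 t)) := by
    refine Integrable.mono' (hhki.const_mul (1 / (4 * ν))) ((hgc.pow 2).aestronglyMeasurable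
      measurableSet_Ioo) ?_
    refine (ae_restrict_iff' measurableSet_Ioo).2 (ae_of_all _ fun τ hτ => ?_)
    rw [Real.norm_eq_abs, abs_of_nonneg (sq_nonneg _)]
    exact hg2 τ hτ
  have hCS := sq_integral_mul_le_of_sq_integrable hfm hgm hf0 hg0 hf2i hg2i
  -- assemble
  have hI : ∫ τ in Ioo 0 t, f τ ^ 2 = ∫ τ in Ioo 0 t, w τ :=
    setIntegral_congr_fun measurableSet_Ioo hf2
  have hfgI : ∫ τ in Ioo 0 t, f τ * g τ = ∫ τ in Ioo 0 t, e τ * Bk τ :=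
    setIntegral_congr_fun measurableSet_Ioo hfg
  have hgI : ∫ τ in Ioo 0 t, g τ ^ 2 ≤ 1 / (4 * ν) * ∫ τ in Ioo 0 t, hk' τ := by
    rw [← integral_const_mul]
    exact setIntegral_mono_on hg2i (hhki.const_mul _) measurableSet_Ioo hg2
  have hmode0 : 0 ≤ ∫ τ in Ioo 0 t, e τ * Bk τ :=
    setIntegral_nonneg measurableSet_Ioo fun τ _ => mul_nonneg (he0 τ) (hBk0 τ)
  calc ‖mFourierCoeff (EuclideanSpace.complexify ∘ u t) k‖ ^ 2
      ≤ (∫ τ in Ioo 0 t, e τ * Bk τ) ^ 2 := pow_le_pow_left₀ (norm_nonneg _) hmode 2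
    _ = (∫ τ in Ioo 0 t, f τ * g τ) ^ 2 := by rw [hfgI]
    _ ≤ (∫ τ in Ioo 0 t, f τ ^ 2) * ∫ τ in Ioo 0 t, g τ ^ 2 := hCS
    _ ≤ (∫ τ in Ioo 0 t, w τ) * (1 / (4 * ν) * ∫ τ in Ioo 0 t, hk' τ) := by
        rw [hI]
        exact mul_le_mul_of_nonneg_left hgI hI0

omit [DecidableEq d] in
/-- The zeroth Fourier coefficient of a mean-zero continuous real field vanishes:
`𝓕(complexify ∘ w)(0) = complexify (∫ w) = 0` (twin, for continuous fields, of
`mFourierCoeff_complexify_zero_of_hasZeroMean` of `DoeringFoiasProofs`, not imported here). [folklore] -/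
theorem mFourierCoeff_complexify_zero_of_continuous_of_hasZeroMean {w : UnitAddTorus d → EuclideanSpace ℝ d}
    (hw : Continuous w) (h0 : HasZeroMean w) :
    mFourierCoeff (EuclideanSpace.complexify ∘ w) 0 = 0 := by
  rw [mFourierCoeff_eq_integral_volume]
  simp only [neg_zero, mFourier_zero, ContinuousMap.one_apply, one_smul, Function.comp_apply]
  have h := (EuclideanSpace.complexify (ι := d)).toContinuousLinearMap.integral_comp_comm
    hw.integrable_unitAddTorus
  simp only [LinearIsometry.coe_toContinuousLinearMap] at h
  rw [h]
  unfold HasZeroMean at h0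
  rw [h0, map_zero]

omit [DecidableEq d] in
/-- Integrability on `(0, t)` of `τ ↦ (t-τ)^{-1/2} ∫ ‖u(τ)‖²` for a jointly smooth field in the
Kato class (continuous on `(0, t)`, at most `M² (t-τ)^{-1/2} τ^{-2β}`). [folklore] -/
theorem integrableOn_rpow_mul_integral_norm_sq (hu : IsSmoothSpaceTimeOn (Ioc 0 T) u) {M β : ℝ}
    (hβ : 0 ≤ β) (hβ2 : 2 * β < 1) (hM : ∀ τ ∈ Ioc 0 T, ∀ x, ‖u τ x‖ ≤ M * τ ^ (-β)) {t : ℝ}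
    (ht : t ∈ Ioc 0 T) :
    IntegrableOn (fun τ => (t - τ) ^ (-(1 / 2 : ℝ)) * ∫ x, ‖u τ x‖ ^ 2) (Ioo 0 t) := by
  have ht0 : 0 < t := ht.1
  have hsub : Ioo 0 t ⊆ Ioc 0 T := fun τ hτ => ⟨hτ.1, hτ.2.le.trans ht.2⟩
  have hE0 : ∀ τ, 0 ≤ ∫ x, ‖u τ x‖ ^ 2 := fun τ => integral_nonneg fun x => sq_nonneg _
  have hEbd : ∀ τ ∈ Ioc 0 T, ∫ x, ‖u τ x‖ ^ 2 ≤ M ^ 2 * τ ^ (-(2 * β)) := fun τ hτ =>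
    integral_norm_sq_le_of_norm_le (hu.isSmooth_slice hτ).continuous hτ.1 (hM τ hτ)
  have hEc : ContinuousOn (fun τ => ∫ x, ‖u τ x‖ ^ 2) (Ioc 0 T) :=
    continuousOn_integral_norm_sq_of_continuousOn_stLift hu.continuousOn_stLift
  have hwi : IntegrableOn (fun τ => (t - τ) ^ (-(1 / 2 : ℝ)) * τ ^ (-(2 * β))) (Ioo 0 t) :=
    (setIntegral_abel_rpow_rpow_le (a := 1 / 2) (b := 2 * β) (by norm_num) (by norm_num)
      (by linarith) hβ2 ht0).1
  have hpow1 : ContinuousOn (fun τ : ℝ => (t - τ) ^ (-(1 / 2 : ℝ))) (Ioo 0 t) :=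
    (continuousOn_const.sub continuousOn_id).rpow_const fun τ hτ => Or.inl (sub_pos.2 hτ.2).ne'
  refine Integrable.mono' (hwi.const_mul (M ^ 2))
    ((hpow1.mul (hEc.mono hsub)).aestronglyMeasurable measurableSet_Ioo) ?_
  refine (ae_restrict_iff' measurableSet_Ioo).2 (ae_of_all _ fun τ hτ => ?_)
  have h1 : 0 ≤ (t - τ) ^ (-(1 / 2 : ℝ)) := Real.rpow_nonneg (sub_nonneg.2 hτ.2.le) _
  rw [Real.norm_eq_abs, abs_of_nonneg (mul_nonneg h1 (hE0 τ))]
  calc (t - τ) ^ (-(1 / 2 : ℝ)) * ∫ x, ‖u τ x‖ ^ 2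
      ≤ (t - τ) ^ (-(1 / 2 : ℝ)) * (M ^ 2 * τ ^ (-(2 * β))) :=
        mul_le_mul_of_nonneg_left (hEbd τ (hsub hτ)) h1
    _ = M ^ 2 * ((t - τ) ^ (-(1 / 2 : ℝ)) * τ ^ (-(2 * β))) := by ring

/-- **The closed `L²` inequality in the Kato class.** For a mean-zero classical solution of the
unforced Navier–Stokes system (`ν > 0`) on `(0, T] × T^d` with `‖u(τ,x)‖ ≤ M τ^{-β}`
(`0 ≤ β`, `2β < 1`) and weakly vanishing datum (pairings with the divergence-free single modes
tend to `0`), for every `t ∈ (0, T]`: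
`∫ ‖u(t)‖² ≤ (M²/4ν) · I(t) · ∫_{(0,t)} (t-τ)^{-1/2} ∫ ‖u(τ)‖² dτ`,
`I(t) = ∫_{(0,t)} (t-τ)^{-1/2} τ^{-2β} dτ` (Parseval `∫‖u(t)‖² = ∑_k ‖û(t,k)‖²`, `û(t,0) = 0`,
the squared mode bounds summed over `k` with `∑_k ‖𝓕(u⊗u)(τ,k)‖² = ∫ ‖u(τ)‖⁴ ≤ M²τ^{-2β} ∫‖u(τ)‖²`).
[folklore] -/
theorem integral_norm_sq_le_of_kato (h : IsClassicalNSSolutionOn (Ioc 0 T) ν 0 u p) (hν : 0 < ν)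
    (hlim : ∀ k : d → ℤ, k ≠ 0 → ∀ z : EuclideanSpace ℂ d, (∑ j, (k j : ℂ) * z j = 0) →
      Tendsto (fun t => ∫ x, ⟪u t x, realTrigPoly {k} (fun _ => z) x⟫) (𝓝[>] 0) (𝓝 0))
    (hmean : ∀ t ∈ Ioc 0 T, HasZeroMean (u t))
    {M β : ℝ} (hβ : 0 ≤ β) (hβ2 : 2 * β < 1)
    (hM : ∀ τ ∈ Ioc 0 T, ∀ x, ‖u τ x‖ ≤ M * τ ^ (-β)) {t : ℝ} (ht : t ∈ Ioc 0 T) :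
    ∫ x, ‖u t x‖ ^ 2 ≤
      M ^ 2 / (4 * ν) * (∫ τ in Ioo 0 t, (t - τ) ^ (-(1 / 2 : ℝ)) * τ ^ (-(2 * β))) *
        ∫ τ in Ioo 0 t, (t - τ) ^ (-(1 / 2 : ℝ)) * ∫ x, ‖u τ x‖ ^ 2 := by
  set S : Set ℝ := Ioc 0 T with hSdef
  set E : ℝ → ℝ := fun τ => ∫ x, ‖u τ x‖ ^ 2 with hE
  set I : ℝ := ∫ τ in Ioo 0 t, (t - τ) ^ (-(1 / 2 : ℝ)) * τ ^ (-(2 * β)) with hI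
  have ht0 : 0 < t := ht.1
  have hu := h.smooth_velocity
  have hsub : Ioo 0 t ⊆ S := fun τ hτ => ⟨hτ.1, hτ.2.le.trans ht.2⟩
  have hM0 : 0 ≤ M := by
    have h1 := hM t ht (0 : UnitAddTorus d)
    have h2 : 0 < t ^ (-β) := Real.rpow_pos_of_pos ht0 _
    nlinarith [norm_nonneg (u t 0)]
  have hE0 : ∀ τ, 0 ≤ E τ := fun τ => integral_nonneg fun x => sq_nonneg _
  have hEbd : ∀ τ ∈ S, E τ ≤ M ^ 2 * τ ^ (-(2 * β)) := fun τ hτ =>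
    integral_norm_sq_le_of_norm_le (hu.isSmooth_slice hτ).continuous hτ.1 (hM τ hτ)
  have hEc : ContinuousOn E S := continuousOn_integral_norm_sq_of_continuousOn_stLift hu.continuousOn_stLift
  have hwi : IntegrableOn (fun τ => (t - τ) ^ (-(1 / 2 : ℝ)) * τ ^ (-(2 * β))) (Ioo 0 t) :=
    (setIntegral_abel_rpow_rpow_le (a := 1 / 2) (b := 2 * β) (by norm_num) (by norm_num)
      (by linarith) hβ2 ht0).1
  have hI0 : 0 ≤ I :=
    setIntegral_nonneg measurableSet_Ioo fun τ hτ => mul_nonneg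
      (Real.rpow_nonneg (sub_nonneg.2 hτ.2.le) _) (Real.rpow_nonneg hτ.1.le _)
  -- integrability of `(t-τ)^{-1/2} E τ` on `(0, t)`
  have hREi : IntegrableOn (fun τ => (t - τ) ^ (-(1 / 2 : ℝ)) * E τ) (Ioo 0 t) :=
    integrableOn_rpow_mul_integral_norm_sq hu hβ hβ2 hM ht
  -- the bound for finite sums over nonzero frequencies
  set C : ℝ := M ^ 2 / (4 * ν) * I * ∫ τ in Ioo 0 t, (t - τ) ^ (-(1 / 2 : ℝ)) * E τ with hC
  have hfin : ∀ K : Finset (d → ℤ), (∀ k ∈ K, k ≠ 0) →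
      ∑ k ∈ K, ‖mFourierCoeff (EuclideanSpace.complexify ∘ u t) k‖ ^ 2 ≤ C := by
    intro K hK
    -- the weighted tensor integrands
    set hk : (d → ℤ) → ℝ → ℝ := fun k τ => (t - τ) ^ (-(1 / 2 : ℝ)) * τ ^ (2 * β) *
      ‖mFourierCoeff (fun x => (WithLp.toLp 2 fun ij : d × d =>
        ((u τ x ij.1 * u τ x ij.2 : ℝ) : ℂ) : EuclideanSpace ℂ (d × d))) (-k)‖ ^ 2 with hhk
    have hki : ∀ k, IntegrableOn (hk k) (Ioo 0 t) := fun k =>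
      (integrableOn_weight_mul_sq_norm_mFourierCoeff_tensorSq hu hβ hβ2 hM ht (-k)).1
    have h1 : ∑ k ∈ K, ‖mFourierCoeff (EuclideanSpace.complexify ∘ u t) k‖ ^ 2 ≤
        ∑ k ∈ K, I * (1 / (4 * ν) * ∫ τ in Ioo 0 t, hk k τ) :=
      Finset.sum_le_sum fun k hkK => sq_norm_mFourierCoeff_le_of_kato h hν hlim hβ hβ2 hM ht (hK k hkK)
    have h2 : ∑ k ∈ K, I * (1 / (4 * ν) * ∫ τ in Ioo 0 t, hk k τ) =
        I * (1 / (4 * ν)) * ∫ τ in Ioo 0 t, ∑ k ∈ K, hk k τ := by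
      rw [integral_finsetSum _ fun k _ => hki k, Finset.mul_sum]
      refine Finset.sum_congr rfl fun k _ => ?_
      ring
    -- pointwise: `∑_{k∈K} hk k τ ≤ M² (t-τ)^{-1/2} E τ`
    have h3 : ∀ τ ∈ Ioo 0 t, ∑ k ∈ K, hk k τ ≤ M ^ 2 * ((t - τ) ^ (-(1 / 2 : ℝ)) * E τ) := by
      intro τ hτ
      have hc : Continuous (u τ) := (hu.isSmooth_slice (hsub hτ)).continuous
      have hw1 : 0 ≤ (t - τ) ^ (-(1 / 2 : ℝ)) := Real.rpow_nonneg (sub_nonneg.2 hτ.2.le) _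
      have hw2 : 0 ≤ τ ^ (2 * β) := Real.rpow_nonneg hτ.1.le _
      simp only [hhk]
      rw [← Finset.mul_sum]
      have hP := (sum_norm_sq_mFourierCoeff_tensorSq_le hc K).trans
        (integral_norm_tensorSq_sq_le hc hτ.1 (hM τ (hsub hτ)))
      have hcancel : τ ^ (2 * β) * (M ^ 2 * τ ^ (-(2 * β))) = M ^ 2 := by
        rw [mul_comm, mul_assoc, ← Real.rpow_add hτ.1]
        norm_num
      calc (t - τ) ^ (-(1 / 2 : ℝ)) * τ ^ (2 * β) *
            ∑ k ∈ K, ‖mFourierCoeff (fun x => (WithLp.toLp 2 fun ij : d × d =>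
              ((u τ x ij.1 * u τ x ij.2 : ℝ) : ℂ) : EuclideanSpace ℂ (d × d))) (-k)‖ ^ 2
          ≤ (t - τ) ^ (-(1 / 2 : ℝ)) * τ ^ (2 * β) * (M ^ 2 * τ ^ (-(2 * β)) * E τ) :=
            mul_le_mul_of_nonneg_left hP (mul_nonneg hw1 hw2)
        _ = (τ ^ (2 * β) * (M ^ 2 * τ ^ (-(2 * β)))) * ((t - τ) ^ (-(1 / 2 : ℝ)) * E τ) := by ring
        _ = M ^ 2 * ((t - τ) ^ (-(1 / 2 : ℝ)) * E τ) := by rw [hcancel]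
    have h4 : ∫ τ in Ioo 0 t, ∑ k ∈ K, hk k τ ≤ M ^ 2 * ∫ τ in Ioo 0 t, (t - τ) ^ (-(1 / 2 : ℝ)) * E τ := by
      rw [← integral_const_mul]
      exact setIntegral_mono_on (integrable_finsetSum _ fun k _ => hki k) (hREi.const_mul _)
        measurableSet_Ioo h3
    have hν4 : 0 ≤ I * (1 / (4 * ν)) := mul_nonneg hI0 (by positivity)
    calc ∑ k ∈ K, ‖mFourierCoeff (EuclideanSpace.complexify ∘ u t) k‖ ^ 2
        ≤ I * (1 / (4 * ν)) * ∫ τ in Ioo 0 t, ∑ k ∈ K, hk k τ := h1.trans h2.le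
      _ ≤ I * (1 / (4 * ν)) * (M ^ 2 * ∫ τ in Ioo 0 t, (t - τ) ^ (-(1 / 2 : ℝ)) * E τ) :=
          mul_le_mul_of_nonneg_left h4 hν4
      _ = C := by
          simp only [hC]
          ring
  -- Parseval and the vanishing zeroth coefficient
  have hut : IsSmooth (u t) := hu.isSmooth_slice ht
  have hPars : E t = ∑' k : d → ℤ, ‖mFourierCoeff (EuclideanSpace.complexify ∘ u t) k‖ ^ 2 :=
    integral_norm_sq_eq_tsum (hut.memLp 2)
  have h00 : ‖mFourierCoeff (EuclideanSpace.complexify ∘ u t) 0‖ ^ 2 = 0 := by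
    rw [mFourierCoeff_complexify_zero_of_continuous_of_hasZeroMean hut.continuous (hmean t ht), norm_zero,
      sq, mul_zero]
  change E t ≤ C
  rw [hPars]
  refine Real.tsum_le_of_sum_le (fun k => sq_nonneg _) fun K => ?_
  rw [← Finset.sum_erase K h00]
  exact hfin (K.erase 0) fun k hk => Finset.ne_of_mem_erase hk

end KeyInequality

/-! ## The bootstrap: uniqueness from zero datum in the Kato class -/

section Main

variable {T ν : ℝ} {u : ℝ → UnitAddTorus d → EuclideanSpace ℝ d} {p : ℝ → UnitAddTorus d → ℝ}

/-- **Uniqueness from zero datum in Kato's weighted class (classical solutions on `T^d`).**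
Let `(u, p)` be a classical solution of the unforced incompressible Navier–Stokes system with
viscosity `ν > 0` on `(0, T] × T^d` (`Torus.IsClassicalNSSolutionOn (Ioc 0 T) ν 0 u p`) such that
* `∫ u(t) = 0` for `t ∈ (0, T]`;
* `‖u(t, x)‖ ≤ M t^{-β}` on `(0, T] × T^d` with `0 ≤ β`, `2β < 1`;
* `∫ ⟪u(t), Re (e_k z)⟫ → 0` as `t → 0⁺` for every `k ≠ 0` and `z ∈ ℂ^d` with `k · z = 0`;
* `M² (2/(1-2β) + 4)² T^{1-2β} < 4ν`.
Then `u(t) = 0` for all `t ∈ (0, T]`. Proof: by `integral_norm_sq_le_of_kato` and the Abel–Beta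
bound `I(t) ≤ C_β t^{1/2-2β}`, `C_β = 2/(1-2β) + 4`, the bound `∫‖u(τ)‖² ≤ R τ^{-2β}` on `(0, T]`
improves to `∫‖u(t)‖² ≤ ρ R t^{-2β}` with `ρ = M² C_β² T^{1-2β}/(4ν) < 1`; starting from `R = M²`
and iterating, `∫ ‖u(t)‖² = 0`. (Kato 1984, proof of Thm. 1; Brezis 1994 — uniqueness when
`t^{1/2}‖u(t)‖_∞ → 0`; here on the torus, for classical solutions singular at `t = 0`.) [folklore] -/
theorem _root_.Literature.Analysis.FunctionSpaces.Torus.IsClassicalNSSolutionOn.eq_zero_of_kato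
    (h : IsClassicalNSSolutionOn (Ioc 0 T) ν 0 u p) (hν : 0 < ν)
    (hmean : ∀ t ∈ Ioc 0 T, HasZeroMean (u t))
    {M β : ℝ} (hβ : 0 ≤ β) (hβ2 : 2 * β < 1)
    (hM : ∀ τ ∈ Ioc 0 T, ∀ x, ‖u τ x‖ ≤ M * τ ^ (-β))
    (hlim : ∀ k : d → ℤ, k ≠ 0 → ∀ z : EuclideanSpace ℂ d, (∑ j, (k j : ℂ) * z j = 0) →
      Tendsto (fun t => ∫ x, ⟪u t x, realTrigPoly {k} (fun _ => z) x⟫) (𝓝[>] 0) (𝓝 0))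
    (hsmall : M ^ 2 * (2 / (1 - 2 * β) + 4) ^ 2 * T ^ (1 - 2 * β) < 4 * ν) :
    ∀ t ∈ Ioc 0 T, u t = 0 := by
  intro t ht
  have hT : 0 < T := ht.1.trans_le ht.2
  set S : Set ℝ := Ioc 0 T with hSdef
  set E : ℝ → ℝ := fun τ => ∫ x, ‖u τ x‖ ^ 2 with hE
  set Cβ : ℝ := 2 / (1 - 2 * β) + 4 with hCβ
  set ρ : ℝ := M ^ 2 * Cβ ^ 2 * T ^ (1 - 2 * β) / (4 * ν) with hρ
  have hu := h.smooth_velocity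
  have hE0 : ∀ τ, 0 ≤ E τ := fun τ => integral_nonneg fun x => sq_nonneg _
  have h12 : 0 < 1 - 2 * β := by linarith
  have hCβ0 : 0 ≤ Cβ := by positivity
  have hTpow : 0 ≤ T ^ (1 - 2 * β) := Real.rpow_nonneg hT.le _
  have hρ0 : 0 ≤ ρ := by positivity
  have hρ1 : ρ < 1 := by
    rw [hρ, div_lt_one (by positivity)]
    calc M ^ 2 * Cβ ^ 2 * T ^ (1 - 2 * β) = M ^ 2 * (2 / (1 - 2 * β) + 4) ^ 2 * T ^ (1 - 2 * β) := by
          rw [hCβ]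
      _ < 4 * ν := hsmall
  have hM0 : 0 ≤ M := by
    have h1 := hM t ht (0 : UnitAddTorus d)
    have h2 : 0 < t ^ (-β) := Real.rpow_pos_of_pos ht.1 _
    nlinarith [norm_nonneg (u t 0)]
  -- the bootstrap step
  have hstep : ∀ R : ℝ, 0 ≤ R → (∀ τ ∈ S, E τ ≤ R * τ ^ (-(2 * β))) →
      ∀ τ ∈ S, E τ ≤ ρ * R * τ ^ (-(2 * β)) := by
    intro R hR hER s hs
    have hs0 : 0 < s := hs.1
    have hsub : Ioo 0 s ⊆ S := fun τ hτ => ⟨hτ.1, hτ.2.le.trans hs.2⟩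
    have hkey := integral_norm_sq_le_of_kato h hν hlim hmean hβ hβ2 hM hs
    obtain ⟨hwi, hIle⟩ := setIntegral_abel_rpow_rpow_le (a := 1 / 2) (b := 2 * β) (t := s)
      (by norm_num) (by norm_num) (by linarith) hβ2 hs0
    set I : ℝ := ∫ τ in Ioo 0 s, (s - τ) ^ (-(1 / 2 : ℝ)) * τ ^ (-(2 * β)) with hI
    have hI0 : 0 ≤ I :=
      setIntegral_nonneg measurableSet_Ioo fun τ hτ => mul_nonneg
        (Real.rpow_nonneg (sub_nonneg.2 hτ.2.le) _) (Real.rpow_nonneg hτ.1.le _)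
    have hICβ : I ≤ Cβ * s ^ (1 / 2 - 2 * β) := by
      have : (1 : ℝ) - 1 / 2 - 2 * β = 1 / 2 - 2 * β := by ring
      rw [this] at hIle
      have hC : 2 / (1 - 2 * β) + 2 / (1 - 1 / 2) = Cβ := by rw [hCβ]; norm_num
      rw [hC] at hIle
      exact hIle
    -- `∫ (s-τ)^{-1/2} E τ ≤ R I`
    have hREi := integrableOn_rpow_mul_integral_norm_sq hu hβ hβ2 hM hs
    have hJ : ∫ τ in Ioo 0 s, (s - τ) ^ (-(1 / 2 : ℝ)) * E τ ≤ R * I := by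
      rw [hI, ← integral_const_mul]
      refine setIntegral_mono_on hREi (hwi.const_mul R) measurableSet_Ioo fun τ hτ => ?_
      have h1 : 0 ≤ (s - τ) ^ (-(1 / 2 : ℝ)) := Real.rpow_nonneg (sub_nonneg.2 hτ.2.le) _
      calc (s - τ) ^ (-(1 / 2 : ℝ)) * E τ ≤ (s - τ) ^ (-(1 / 2 : ℝ)) * (R * τ ^ (-(2 * β))) :=
            mul_le_mul_of_nonneg_left (hER τ (hsub hτ)) h1
        _ = R * ((s - τ) ^ (-(1 / 2 : ℝ)) * τ ^ (-(2 * β))) := by ring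
    -- powers of `s`
    have hspow : (s ^ (1 / 2 - 2 * β)) ^ 2 ≤ T ^ (1 - 2 * β) * s ^ (-(2 * β)) := by
      have h1 : (s ^ (1 / 2 - 2 * β)) ^ 2 = s ^ (1 - 2 * β) * s ^ (-(2 * β)) := by
        rw [← Real.rpow_natCast, ← Real.rpow_mul hs0.le, ← Real.rpow_add hs0]
        congr 1
        push_cast
        ring
      rw [h1]
      exact mul_le_mul_of_nonneg_right (Real.rpow_le_rpow hs0.le hs.2 h12.le)
        (Real.rpow_nonneg hs0.le _)
    have hMν : 0 ≤ M ^ 2 / (4 * ν) := by positivity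
    calc E s ≤ M ^ 2 / (4 * ν) * I * ∫ τ in Ioo 0 s, (s - τ) ^ (-(1 / 2 : ℝ)) * E τ := hkey
      _ ≤ M ^ 2 / (4 * ν) * I * (R * I) :=
          mul_le_mul_of_nonneg_left hJ (mul_nonneg hMν hI0)
      _ = M ^ 2 / (4 * ν) * R * I ^ 2 := by ring
      _ ≤ M ^ 2 / (4 * ν) * R * (Cβ * s ^ (1 / 2 - 2 * β)) ^ 2 := by
          gcongr
      _ = M ^ 2 / (4 * ν) * R * Cβ ^ 2 * (s ^ (1 / 2 - 2 * β)) ^ 2 := by ring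
      _ ≤ M ^ 2 / (4 * ν) * R * Cβ ^ 2 * (T ^ (1 - 2 * β) * s ^ (-(2 * β))) := by
          gcongr
      _ = ρ * R * s ^ (-(2 * β)) := by
          simp only [hρ]
          ring
  -- iterate from `R = M²`
  have hiter : ∀ n : ℕ, ∀ τ ∈ S, E τ ≤ ρ ^ n * M ^ 2 * τ ^ (-(2 * β)) := by
    intro n
    induction n with
    | zero =>
        intro τ hτ
        rw [pow_zero, one_mul]
        exact integral_norm_sq_le_of_norm_le (hu.isSmooth_slice hτ).continuous hτ.1 (hM τ hτ)
    | succ n ih =>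
        intro τ hτ
        have := hstep (ρ ^ n * M ^ 2) (by positivity) ih τ hτ
        calc E τ ≤ ρ * (ρ ^ n * M ^ 2) * τ ^ (-(2 * β)) := this
          _ = ρ ^ (n + 1) * M ^ 2 * τ ^ (-(2 * β)) := by ring
  -- pass to the limit `n → ∞`
  have hlim0 : Tendsto (fun n : ℕ => ρ ^ n * M ^ 2 * t ^ (-(2 * β))) atTop (𝓝 (0 * M ^ 2 * t ^ (-(2 * β)))) :=
    ((tendsto_pow_atTop_nhds_zero_of_lt_one hρ0 hρ1).mul_const _).mul_const _
  rw [zero_mul, zero_mul] at hlim0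
  have hEt : E t ≤ 0 := ge_of_tendsto' hlim0 fun n => hiter n t ht
  exact eq_zero_of_integral_norm_sq_nonpos (hu.isSmooth_slice ht) hEt

/-- **Uniqueness from zero datum in Kato's weighted class**, with the weak zero datum stated
against all smooth mean-zero test fields: a mean-zero classical solution of the unforced
Navier–Stokes system (`ν > 0`) on `(0, T] × T^d` with `‖u(t,x)‖ ≤ M t^{-β}` (`0 ≤ β`, `2β < 1`),
`∫ ⟪u(t), φ⟫ → 0` as `t → 0⁺` for every smooth mean-zero `φ`, and
`M² (2/(1-2β) + 4)² T^{1-2β} < 4ν`, vanishes identically on `(0, T]`. [folklore] -/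
theorem _root_.Literature.Analysis.FunctionSpaces.Torus.IsClassicalNSSolutionOn.eq_zero_of_kato_of_pairing
    (h : IsClassicalNSSolutionOn (Ioc 0 T) ν 0 u p) (hν : 0 < ν)
    (hmean : ∀ t ∈ Ioc 0 T, HasZeroMean (u t))
    {M β : ℝ} (hβ : 0 ≤ β) (hβ2 : 2 * β < 1)
    (hM : ∀ τ ∈ Ioc 0 T, ∀ x, ‖u τ x‖ ≤ M * τ ^ (-β))
    (hlim : ∀ φ : UnitAddTorus d → EuclideanSpace ℝ d, IsSmooth φ → HasZeroMean φ →
      Tendsto (fun t => ∫ x, ⟪u t x, φ x⟫) (𝓝[>] 0) (𝓝 0))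
    (hsmall : M ^ 2 * (2 / (1 - 2 * β) + 4) ^ 2 * T ^ (1 - 2 * β) < 4 * ν) :
    ∀ t ∈ Ioc 0 T, u t = 0 := by
  -- single real modes at nonzero frequency are smooth and have zero mean (`∫ e_k = 0`)
  have hzm : ∀ {k : d → ℤ}, k ≠ 0 → ∀ c : (d → ℤ) → EuclideanSpace ℂ d,
      HasZeroMean (realTrigPoly {k} c) := by
    intro k hk c
    unfold HasZeroMean
    simp_rw [realTrigPoly_singleton_apply]
    have hint : Integrable (fun x => mFourier k x • c k) volume :=
      ((mFourier k).continuous.smul continuous_const).integrable_unitAddTorus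
    have h := (EuclideanSpace.realPart (ι := d)).integral_comp_comm hint
    rw [h, integral_smul_const, integral_mFourier, if_neg hk, zero_smul, map_zero]
  exact h.eq_zero_of_kato hν hmean hβ hβ2 hM
    (fun _ hk _ _ => hlim _ (isSmooth_realTrigPoly _ _) (hzm hk _)) hsmall

end Main





end Literature.Analysis.FluidPDE

end
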